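import Literature.Probability.RandomPlanarGeometry.SAWWords
import Literature.Probability.RandomPlanarGeometry.SAWTubeCountConventions
import Mathlib.Analysis.SpecialFunctions.Log.Basic
import Mathlib.Analysis.Asymptotics.Defs
import HarnessLib

/-!
# An explicit margin in `μ(ℤ × {0,…,L}) < μ(ℤ²)` (Madras–Slade (8.2.11), planar strips)

Topic `Literature/Probability/RandomPlanarGeometry` (continues `SAWTubeCount.lean` /
`SAWTubeCountConventions.lean`: the tubes `R[k,T]`, `Zd.tubeCount`, `Zd.tubeConnectiveConstant d k T = μ(R[k,T])`,
`Zd.tubeWalksFrom`; and `SAWWords.lean`: step words `traj`, `IsSAW`, `sawWords`, `card_sawWords = cₙ`).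
Source: N. Madras, G. Slade, *The Self-Avoiding Walk* (Birkhäuser 1993), §8.2, Theorem 8.2.1,
eq. (8.2.11): "`μ(R[k,T]) < μ` for every `T`" (book p. 281; PDF chunk p0281 L14–L21 of the corpus copy
`book:madras1993-self-avoiding-walk`, 436 pp.), proved there as "an immediate consequence of the Pattern
Theorem (Theorem 7.2.3)". Companion of `SAWTubeLocality.lean` (`Zd.log_sub_log_tubeConnectiveConstant_le`,
the explicit UPPER rate `log μ - log μ(R[k,T]) ≤ 45/√T`).

## What is proved (case `d = 2`, `k = 1`: the strips `R[1,L] = ℤ × {0,…,L}`)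

* **`Zd.tubeConnectiveConstant_two_one_lt (L) : μ(R[1,L]) < μ(ℤ²)`** — (8.2.11) as printed, planar case,
  with a CONSTRUCTIVE proof (no pattern theorem, no transfer matrix);
* **`Zd.log_sub_log_tubeConnectiveConstant_two_one_ge (L)`** — the quantitative form (this file):
  `log(1 + μ^{-(2L+4)}) / (L+1) ≤ log μ - log μ(R[1,L])` for every `L ≥ 0`, `μ = μ(ℤ²)`.

## The argument (two-column insertion; lane «pcv-sawmu» 2026-08-22, idea card a-idea-2 ROUTES §11)

Fix `L`, a starting height `a ∈ {0,…,L}` and an `n`-step self-avoiding word `w` staying in the rows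
`-a ≤ y ≤ L - a`. (1) COLUMNS: the `n+1` distinct vertices occupy at least `(n+1)/(L+1)` columns, which
form an interval, so at least `(n+1)/(L+1) - 1` column cuts `x | x+1` are crossed (discrete intermediate
value); each crossed cut has a unique TOP strand (highest crossing edge — two crossings of a cut at the same
height would use the same edge twice). (2) INSERTION: for a set `T` of top strands, `Ψ(w,T)` replaces every
crossing `s ∈ {E, W}` of a selected cut by `s s s`, except the top one, replaced by the excursion
`s N^j s S^j s` reaching the row `L + 1 - a` exactly (`j = L + 1 - a - y`); in the step-word model the
columns right of the cut are thereby shifted by `2` automatically. `Ψ(w,T)` is self-avoiding: the inserted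
vertices lie in the two new columns of their cut, stretched strands at their own (pairwise distinct) rows,
the excursion above the top strand. (3) DECODING: a step of `Ψ(w,T)` enters a column containing a vertex at
row `L + 1 - a` iff it is not the last step of its block, so the block boundaries — hence `w` and `T` — are
determined: `(w,T) ↦ Ψ(w,T)` is injective for fixed `(L, a, n)`. (4) COST: the stretched strands of a cut
sit at distinct rows of `[-a, y_top)`, so a selected cut costs at most `2(y_top + a) + 2(L + 1 - a - y_top)
+ 2 = 2L + 4` extra steps. (5) COUNTING, for `0 ≤ x ≤ 1`:
`#{w} · xⁿ (1 + x^{2L+4})^{(n+1)/(L+1) - 1} ≤ Σ_w Σ_{T} x^{|Ψ(w,T)|} ≤ Σ_{m=n}^{(2L+5)n} c_m x^m`.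
(6) EXTRACTION: summing over `a`, using `c_N(R) ≥ μ(R)^N`, `c_m x^m` bounded for `x < 1/μ`
(`c_m^{1/m} → μ`) and `log n = o(n)`: `log(μ(R) x) + log(1 + x^{2L+4})/(L+1) ≤ 0` for `0 < x < 1/μ`;
let `x → 1/μ`.

The margin is poor (`≍ μ^{-2L}` against the true `≍ L^{-4/3}`) but explicit, unconditional and valid for
every `L`; no explicit lower locality rate was found in print (lane literature passes 2026-08-22:
Madras–Slade §8.2 and Janse van Rensburg 2015 §6.5 are qualitative; Hammersley–Whittington 1985 and
Soteros–Whittington 1989 not held — label PROVISIONAL). All helpers are `private`; the insertion machinery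
lives in the sub-namespace `StripInsert`.
-/

noncomputable section

open Finset Filter Literature.Probability.LatticeModels SimpleGraph
open scoped BigOperators Topology

namespace Literature.Probability.RandomPlanarGeometry.SAW

namespace StripInsert

/-! ### Concatenations of blocks -/

/-- Concatenation of the blocks `F 0, …, F (n-1)`. [folklore] -/
private def blocks (F : ℕ → List Step) (n : ℕ) : List Step := (List.range n).flatMap F

/-- Total length of the first `t` blocks. [folklore] -/
private def blen (F : ℕ → List Step) (t : ℕ) : ℕ := ∑ s ∈ range t, (F s).length

/-- Total displacement of the first `t` blocks. [folklore] -/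
private def bend (F : ℕ → List Step) (t : ℕ) : Site 2 := ∑ s ∈ range t, wEnd (F s)

/-- `blocks F (n+1) = blocks F n ++ F n`. [folklore] -/
private theorem blocks_succ (F : ℕ → List Step) (n : ℕ) : blocks F (n + 1) = blocks F n ++ F n := by
  simp [blocks, List.range_succ, List.flatMap_append]

/-- `blen F (t+1) = blen F t + |F t|`. [folklore] -/
private theorem blen_succ (F : ℕ → List Step) (t : ℕ) : blen F (t + 1) = blen F t + (F t).length := by
  rw [blen, blen, sum_range_succ]

/-- `bend F (t+1) = bend F t + wEnd (F t)`. [folklore] -/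
private theorem bend_succ (F : ℕ → List Step) (t : ℕ) : bend F (t + 1) = bend F t + wEnd (F t) := by
  rw [bend, bend, sum_range_succ]

/-- `blen F 0 = 0`. [folklore] -/
@[simp] private theorem blen_zero (F : ℕ → List Step) : blen F 0 = 0 := by simp [blen]

/-- `bend F 0 = 0`. [folklore] -/
@[simp] private theorem bend_zero (F : ℕ → List Step) : bend F 0 = 0 := by simp [bend]

/-- `|blocks F n| = blen F n`. [folklore] -/
private theorem length_blocks (F : ℕ → List Step) (n : ℕ) : (blocks F n).length = blen F n := by
  induction n with
  | zero => simp [blocks, blen]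
  | succ n ih => rw [blocks_succ, List.length_append, ih, blen_succ]

/-- `wEnd (blocks F n) = bend F n`. [folklore] -/
private theorem wEnd_blocks (F : ℕ → List Step) (n : ℕ) : wEnd (blocks F n) = bend F n := by
  induction n with
  | zero => simp [blocks, bend]
  | succ n ih => rw [blocks_succ, wEnd_append, ih, bend_succ]

/-- `blen` is monotone. [folklore] -/
private theorem blen_mono (F : ℕ → List Step) {s t : ℕ} (h : s ≤ t) : blen F s ≤ blen F t := by
  obtain ⟨k, rfl⟩ := Nat.exists_eq_add_of_le h
  clear h
  induction k with
  | zero => simp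
  | succ k ih => rw [← add_assoc, blen_succ]; omega

/-- Splitting off the first `t` blocks. [folklore] -/
private theorem blocks_add (F : ℕ → List Step) (t k : ℕ) :
    blocks F (t + k) = blocks F t ++ (List.range k).flatMap fun s => F (t + s) := by
  induction k with
  | zero => simp [blocks]
  | succ k ih =>
    rw [← add_assoc, blocks_succ, ih, List.range_succ, List.flatMap_append, List.append_assoc]
    simp

/-- The trajectory of a concatenation inside block `t`. [folklore] -/
private theorem traj_blocks (F : ℕ → List Step) {n t r : ℕ} (ht : t < n) (hr : r ≤ (F t).length) :
    traj (blocks F n) (blen F t + r) = bend F t + traj (F t) r := by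
  obtain ⟨k, rfl⟩ : ∃ k, n = t + (k + 1) := ⟨n - t - 1, by omega⟩
  rw [blocks_add, ← length_blocks F t, traj_append_right, wEnd_blocks]
  congr 1
  rw [List.range_succ_eq_map, List.flatMap_cons, Nat.add_zero]
  exact traj_append_left _ _ hr

/-- The letters of a concatenation inside block `t`. [folklore] -/
private theorem getElem?_blocks (F : ℕ → List Step) {n t r : ℕ} (ht : t < n) (hr : r < (F t).length) :
    (blocks F n)[blen F t + r]? = (F t)[r]? := by
  obtain ⟨k, rfl⟩ : ∃ k, n = t + (k + 1) := ⟨n - t - 1, by omega⟩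
  rw [blocks_add, List.getElem?_append_right (by rw [length_blocks]; omega), length_blocks,
    Nat.add_sub_cancel_left, List.range_succ_eq_map, List.flatMap_cons, Nat.add_zero,
    List.getElem?_append_left hr]

/-- Every position of a concatenation of NONEMPTY blocks lies in a block. [folklore] -/
private theorem exists_block (F : ℕ → List Step) (n : ℕ) :
    ∀ i < blen F n, ∃ t < n, ∃ r < (F t).length, i = blen F t + r := by
  induction n with
  | zero => intro i hi; simp at hi
  | succ n ih =>
    intro i hi
    rw [blen_succ] at hi
    by_cases h : i < blen F n
    · obtain ⟨t, ht, r, hr, rfl⟩ := ih i h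
      exact ⟨t, by omega, r, hr, rfl⟩
    · exact ⟨n, by omega, i - blen F n, by omega, by omega⟩

/-! ### Steps -/

/-- Horizontal letters (`±e₀`). A decidable predicate, not a named fact. [folklore] -/
private def IsHoriz (s : Step) : Prop := s = 0 ∨ s = 2

/-- Decidability (by unfolding). [folklore] -/
private instance (s : Step) : Decidable (IsHoriz s) := by unfold IsHoriz; infer_instance

/-- A horizontal letter has `dy = 0`. [folklore] -/
private theorem dy_of_isHoriz {s : Step} (h : IsHoriz s) : Step.dy s = 0 := by
  rcases h with rfl | rfl <;> decide

/-- A horizontal letter has `dx = ±1`. [folklore] -/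
private theorem dx_of_isHoriz {s : Step} (h : IsHoriz s) : Step.dx s = 1 ∨ Step.dx s = -1 := by
  rcases h with rfl | rfl <;> decide

/-- A non-horizontal letter has `dx = 0`. [folklore] -/
private theorem dx_of_not_isHoriz {s : Step} (h : ¬ IsHoriz s) : Step.dx s = 0 := by
  simp only [IsHoriz, not_or] at h
  fin_cases s <;> simp_all [Step.dx]

/-- A non-horizontal letter has `dy = ±1`. [folklore] -/
private theorem dy_of_not_isHoriz {s : Step} (h : ¬ IsHoriz s) : Step.dy s = 1 ∨ Step.dy s = -1 := by
  simp only [IsHoriz, not_or] at h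
  fin_cases s <;> simp_all [Step.dy]

/-- `vec 3 = - vec 1`. [folklore] -/
private theorem vec_three : Step.vec 3 = -Step.vec 1 := by decide

/-- Coordinates of a point written with `vec`. [folklore] -/
private theorem vec_one_eq : Step.vec 1 = Pi.single 1 1 := by decide

/-! ### Geometry of a word: letters, coordinates, cuts -/

/-- The `t`-th letter of `w` (junk `0` beyond the end). [folklore] -/
private def st (w : List Step) (t : ℕ) : Step := w.getD t 0

/-- `st` is the letter. [folklore] -/
private theorem st_eq_getElem (w : List Step) {t : ℕ} (ht : t < w.length) : st w t = w[t] := by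
  simp [st, List.getD_eq_getElem?_getD, List.getElem?_eq_getElem ht]

/-- One step of the trajectory in terms of `st`. [folklore] -/
private theorem traj_succ_st (w : List Step) {t : ℕ} (ht : t < w.length) :
    traj w (t + 1) = traj w t + Step.vec (st w t) := by
  rw [traj_succ w ht, st_eq_getElem w ht]

/-- `x`-coordinate after a step. [folklore] -/
private theorem trajx_succ (w : List Step) {t : ℕ} (ht : t < w.length) :
    traj w (t + 1) 0 = traj w t 0 + Step.dx (st w t) := by
  rw [traj_succ_st w ht]; simp

/-- `y`-coordinate after a step. [folklore] -/
private theorem trajy_succ (w : List Step) {t : ℕ} (ht : t < w.length) :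
    traj w (t + 1) 1 = traj w t 1 + Step.dy (st w t) := by
  rw [traj_succ_st w ht]; simp

/-- The cut crossed by the `t`-th step (for a horizontal step: the left one of the two columns).
[folklore] -/
private def cutOf (w : List Step) (t : ℕ) : ℤ := min (traj w t 0) (traj w (t + 1) 0)

/-- **Top strands**: the `t`-th step is horizontal and no other step crossing the same cut is
higher. A decidable predicate, not a named fact. [folklore] -/
private def IsTop (w : List Step) (t : ℕ) : Prop :=
  t < w.length ∧ IsHoriz (st w t) ∧
    ∀ t' < w.length, IsHoriz (st w t') → cutOf w t' = cutOf w t → traj w t' 1 ≤ traj w t 1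

/-- Decidability (by unfolding). [folklore] -/
private instance (w : List Step) (t : ℕ) : Decidable (IsTop w t) := by unfold IsTop; infer_instance

/-- The top strands of `w` (one per crossed cut). [folklore] -/
private def topTimes (w : List Step) : Finset ℕ := (range w.length).filter (IsTop w)

/-- Given the selected top strands `T`, the `t`-th step is **selected** when it is horizontal and
crosses the cut of a selected top strand. A decidable predicate, not a named fact. [folklore] -/
private def Sel (w : List Step) (T : Finset ℕ) (t : ℕ) : Prop :=
  IsHoriz (st w t) ∧ ∃ t' ∈ T, cutOf w t' = cutOf w t

/-- Decidability (by unfolding). [folklore] -/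
private instance (w : List Step) (T : Finset ℕ) (t : ℕ) : Decidable (Sel w T t) := by
  unfold Sel; infer_instance

/-- Number of selected cuts strictly left of column `X`. [folklore] -/
private def nLeft (w : List Step) (T : Finset ℕ) (X : ℤ) : ℕ := (T.filter fun t' => cutOf w t' < X).card

/-- The column shift: column `X` moves right by twice the number of selected cuts on its left.
[folklore] -/
private def tau (w : List Step) (T : Finset ℕ) (X : ℤ) : ℤ := X + 2 * (nLeft w T X : ℤ)

/-! ### The replacement blocks and the inserted word `Ψ` -/

/-- The middle part `N^j s S^j` of the excursion. [folklore] -/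
private def excCore (s : Step) (j : ℕ) : List Step := List.replicate j 1 ++ s :: List.replicate j 3

/-- The excursion replacing a top crossing `s`: `s N^j s S^j s`. [folklore] -/
private def excWord (s : Step) (j : ℕ) : List Step := (s :: excCore s j) ++ [s]

/-- Height of the excursion over the `t`-th step: it reaches the row `L + 1` exactly. [folklore] -/
private def exc (L : ℕ) (a : ℤ) (w : List Step) (t : ℕ) : ℕ := Int.toNat ((L : ℤ) + 1 - (a + traj w t 1))

/-- The block replacing the `t`-th letter. [folklore] -/
private def rep (L : ℕ) (a : ℤ) (w : List Step) (T : Finset ℕ) (t : ℕ) : List Step :=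
  if t ∈ T then excWord (st w t) (exc L a w t)
  else if Sel w T t then [st w t, st w t] ++ [st w t]
  else [st w t]

/-- **The inserted word `Ψ(w, T)`**: every selected non-top crossing is stretched to three steps,
every selected top crossing is replaced by the excursion over the top of the strip. [folklore] -/
private def Psi (L : ℕ) (a : ℤ) (w : List Step) (T : Finset ℕ) : List Step :=
  blocks (rep L a w T) w.length

/-! ### Elementary properties of the blocks -/

/-- Length of the excursion core. [folklore] -/
@[simp] private theorem length_excCore (s : Step) (j : ℕ) : (excCore s j).length = 2 * j + 1 := by
  simp only [excCore, List.length_append, List.length_replicate, List.length_cons]; ring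

/-- Length of the excursion word. [folklore] -/
@[simp] private theorem length_excWord (s : Step) (j : ℕ) : (excWord s j).length = 2 * j + 3 := by
  simp [excWord]

/-- `3 • v = v + v + v`. [folklore] -/
private theorem three_nsmul_eq (v : Site 2) : 3 • v = v + v + v := by
  rw [show (3 : ℕ) = 1 + 1 + 1 from rfl, add_nsmul, add_nsmul, one_nsmul]

/-- Displacement of a run `s^j`. [folklore] -/
private theorem wEnd_replicate (j : ℕ) (s : Step) : wEnd (List.replicate j s) = j • Step.vec s := by
  simp [wEnd, List.map_replicate, List.sum_replicate]

/-- Displacement of the excursion core: one step `s` (the vertical runs cancel). [folklore] -/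
private theorem wEnd_excCore (s : Step) (j : ℕ) : wEnd (excCore s j) = Step.vec s := by
  simp only [excCore, wEnd_append, wEnd_cons, wEnd_replicate, vec_three, smul_neg]
  abel

/-- Displacement of the excursion word: three steps `s`. [folklore] -/
private theorem wEnd_excWord (s : Step) (j : ℕ) : wEnd (excWord s j) = 3 • Step.vec s := by
  simp only [excWord, wEnd_append, wEnd_cons, wEnd_excCore, wEnd_nil, add_zero, three_nsmul_eq]

/-- Every block is nonempty. [folklore] -/
private theorem length_rep_pos (L : ℕ) (a : ℤ) (w : List Step) (T : Finset ℕ) (t : ℕ) :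
    0 < (rep L a w T t).length := by
  unfold rep; split_ifs <;> simp

/-- Length of a block: `1`, `3` or `2j + 3`. [folklore] -/
private theorem length_rep (L : ℕ) (a : ℤ) (w : List Step) (T : Finset ℕ) (t : ℕ) :
    (rep L a w T t).length =
      if t ∈ T then 2 * exc L a w t + 3 else if Sel w T t then 3 else 1 := by
  unfold rep; split_ifs <;> simp

/-- The last letter of every block is the original letter. [folklore] -/
private theorem getLast_rep (L : ℕ) (a : ℤ) (w : List Step) (T : Finset ℕ) (t : ℕ) :
    (rep L a w T t)[(rep L a w T t).length - 1]? = some (st w t) := by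
  unfold rep
  split_ifs
  · rw [excWord, List.length_append, List.length_singleton, Nat.add_sub_cancel]
    exact List.getElem?_concat_length
  · rw [List.length_append, List.length_singleton, Nat.add_sub_cancel]
    exact List.getElem?_concat_length
  · simp

/-- Displacement of a block: `vec s` for an unselected step, `3 • vec s` for a selected one.
[folklore] -/
private theorem wEnd_rep (L : ℕ) (a : ℤ) (w : List Step) (T : Finset ℕ) (t : ℕ) :
    wEnd (rep L a w T t) =
      if t ∈ T ∨ Sel w T t then 3 • Step.vec (st w t) else Step.vec (st w t) := by
  by_cases h1 : t ∈ T
  · simp only [rep, h1, if_true, true_or, wEnd_excWord]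
  by_cases h2 : Sel w T t
  · simp only [rep, h1, h2, if_false, if_true, or_true, wEnd_append, wEnd_cons, wEnd_nil, add_zero,
      three_nsmul_eq]
  · simp [rep, h1, h2]

/-! ### Coordinates -/

/-- A site of `ℤ²` is determined by its two coordinates. [folklore] -/
private theorem site_ext {v v' : Site 2} (h0 : v 0 = v' 0) (h1 : v 1 = v' 1) : v = v' := by
  funext i
  fin_cases i
  · exact h0
  · exact h1

/-- `dx 1 = 0`. [folklore] -/
@[simp] private theorem dx_one : Step.dx 1 = 0 := by decide
/-- `dy 1 = 1`. [folklore] -/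
@[simp] private theorem dy_one : Step.dy 1 = 1 := by decide

/-- Coordinates of `c • vec s + i • vec 1`. [folklore] -/
private theorem smul_vec_add_apply_zero (s : Step) (c i : ℕ) :
    (c • Step.vec s + i • Step.vec 1) 0 = c * Step.dx s := by
  simp [Pi.add_apply, nsmul_eq_mul]

/-- Coordinates of `c • vec s + i • vec 1`. [folklore] -/
private theorem smul_vec_add_apply_one (s : Step) (c i : ℕ) :
    (c • Step.vec s + i • Step.vec 1) 1 = c * Step.dy s + i := by
  simp [Pi.add_apply, nsmul_eq_mul]

/-! ### Trajectories of the blocks -/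

/-- Inside a leading run `s^j`. [folklore] -/
private theorem traj_replicate_le (s : Step) {j i : ℕ} (hi : i ≤ j) (l : List Step) :
    traj (List.replicate j s ++ l) i = i • Step.vec s := by
  rw [traj_append_left _ _ (by simpa using hi), traj, List.take_replicate, min_eq_left hi,
    wEnd_replicate]

/-- The ascending part of the excursion: after `1 + i` steps (`i ≤ j`) the walk is at
`vec s + i•e₁`. [folklore] -/
private theorem traj_excWord_up (s : Step) (j : ℕ) {i : ℕ} (hi : i ≤ j) :
    traj (excWord s j) (1 + i) = 1 • Step.vec s + i • Step.vec 1 := by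
  rw [excWord, traj_append_left _ _ (by simp; omega),
    show s :: excCore s j = [s] ++ excCore s j from rfl,
    show 1 + i = [s].length + i by simp, traj_append_right, wEnd_singleton, excCore,
    traj_replicate_le _ hi, one_nsmul]

/-- The descending part of the excursion: after `j + 2 + i` steps (`i ≤ j`) the walk is at
`2•vec s + (j-i)•e₁`. [folklore] -/
private theorem traj_excWord_down (s : Step) (j : ℕ) {i : ℕ} (hi : i ≤ j) :
    traj (excWord s j) (j + 2 + i) = 2 • Step.vec s + (j - i) • Step.vec 1 := by
  rw [excWord, traj_append_left _ _ (by simp; omega),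
    show s :: excCore s j = [s] ++ excCore s j from rfl,
    show j + 2 + i = [s].length + (j + (1 + i)) by simp; ring, traj_append_right, wEnd_singleton,
    excCore, show j + (1 + i) = (List.replicate j (1 : Step)).length + (1 + i) by simp,
    traj_append_right, wEnd_replicate, show s :: List.replicate j (3 : Step) = [s] ++ List.replicate j 3
    from rfl, show 1 + i = [s].length + i by simp, traj_append_right, wEnd_singleton,
    show List.replicate j (3 : Step) = List.replicate j 3 ++ [] by simp, traj_replicate_le _ hi,
    vec_three, smul_neg]
  have : j • Step.vec 1 = (j - i) • Step.vec 1 + i • Step.vec 1 := by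
    rw [← add_nsmul, Nat.sub_add_cancel hi]
  rw [this, two_nsmul]
  abel

/-- Every position `1 ≤ r ≤ 2j+2` of the excursion is `c • vec s + i • e₁` with `c ∈ {1,2}`,
`0 ≤ i ≤ j`. [folklore] -/
private theorem traj_excWord_mid (s : Step) (j : ℕ) {r : ℕ} (h1 : 1 ≤ r) (h2 : r ≤ 2 * j + 2) :
    ∃ c i : ℕ, (c = 1 ∨ c = 2) ∧ i ≤ j ∧ traj (excWord s j) r = c • Step.vec s + i • Step.vec 1 := by
  by_cases hr : r ≤ j + 1
  · refine ⟨1, r - 1, Or.inl rfl, by omega, ?_⟩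
    rw [← traj_excWord_up s j (show r - 1 ≤ j by omega)]
    congr 1; omega
  · refine ⟨2, j - (r - (j + 2)), Or.inr rfl, by omega, ?_⟩
    rw [← traj_excWord_down s j (show r - (j + 2) ≤ j by omega)]
    congr 1; omega

/-- The top of the excursion (`i = j`) is reached. [folklore] -/
private theorem traj_excWord_top (s : Step) (j : ℕ) :
    traj (excWord s j) (1 + j) = 1 • Step.vec s + j • Step.vec 1 := traj_excWord_up s j le_rfl

/-- The excursion is a self-avoiding word when `s` is horizontal. [folklore] -/
private theorem isSAW_excWord {s : Step} (hs : IsHoriz s) (j : ℕ) : IsSAW (excWord s j) := by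
  rw [isSAW_iff_injOn]
  have hdx : Step.dx s ≠ 0 := by rcases dx_of_isHoriz hs with h | h <;> simp [h]
  have hdy : Step.dy s = 0 := dy_of_isHoriz hs
  -- position classes: x-coordinate `k * dx s` with `k ∈ {0,1,2,3}` determined by the phase
  have cls : ∀ r ≤ 2 * j + 3, ∃ k i : ℕ, traj (excWord s j) r = k • Step.vec s + i • Step.vec 1 ∧
      ((r = 0 ∧ k = 0 ∧ i = 0) ∨ (1 ≤ r ∧ r ≤ j + 1 ∧ k = 1 ∧ i = r - 1) ∨
       (j + 2 ≤ r ∧ r ≤ 2 * j + 2 ∧ k = 2 ∧ i = 2 * j + 2 - r) ∨ (r = 2 * j + 3 ∧ k = 3 ∧ i = 0)) := by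
    intro r hr
    by_cases h0 : r = 0
    · exact ⟨0, 0, by simp [h0], Or.inl ⟨h0, rfl, rfl⟩⟩
    by_cases hA : r ≤ j + 1
    · refine ⟨1, r - 1, ?_, Or.inr (Or.inl ⟨by omega, hA, rfl, rfl⟩)⟩
      rw [← traj_excWord_up s j (show r - 1 ≤ j by omega)]; congr 1; omega
    by_cases hB : r ≤ 2 * j + 2
    · obtain ⟨i', rfl⟩ : ∃ i', r = j + 2 + i' := ⟨r - (j + 2), by omega⟩
      refine ⟨2, 2 * j + 2 - (j + 2 + i'), ?_, Or.inr (Or.inr (Or.inl ⟨by omega, hB, rfl, rfl⟩))⟩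
      rw [show 2 * j + 2 - (j + 2 + i') = j - i' by omega]
      exact traj_excWord_down s j (by omega)
    · have hr' : r = 2 * j + 3 := by omega
      refine ⟨3, 0, ?_, Or.inr (Or.inr (Or.inr ⟨hr', rfl, rfl⟩))⟩
      rw [hr', show 2 * j + 3 = (excWord s j).length by simp, traj_length, wEnd_excWord, zero_nsmul,
        add_zero]
  intro r hr r' hr' heq
  simp only [Set.mem_setOf_eq, length_excWord] at hr hr'
  obtain ⟨k, i, hk, hc⟩ := cls r hr
  obtain ⟨k', i', hk', hc'⟩ := cls r' hr'
  rw [hk, hk'] at heq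
  have hx := congrFun heq 0
  have hy := congrFun heq 1
  simp only [smul_vec_add_apply_zero] at hx
  simp only [smul_vec_add_apply_one, hdy, mul_zero, zero_add, Nat.cast_inj] at hy
  have hkk : k = k' := by
    have := mul_right_cancel₀ hdx hx
    exact_mod_cast this
  omega

/-- A run `s s s` of a horizontal letter is self-avoiding. [folklore] -/
private theorem isSAW_triple {s : Step} (hs : IsHoriz s) : IsSAW ([s, s] ++ [s]) := by
  rw [isSAW_iff_injOn]
  have hdx : Step.dx s ≠ 0 := by rcases dx_of_isHoriz hs with h | h <;> simp [h]
  have key : ∀ r ≤ 3, traj ([s, s] ++ [s]) r = r • Step.vec s := fun r hr => by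
    rw [show [s, s] ++ [s] = List.replicate 3 s ++ [] from rfl, traj_replicate_le _ hr]
  intro r hr r' hr' heq
  simp only [Set.mem_setOf_eq, List.length_append, List.length_cons, List.length_nil] at hr hr'
  rw [key r (by omega), key r' (by omega)] at heq
  have hx := congrFun heq 0
  simp only [Pi.smul_apply, Step.vec_apply_zero, nsmul_eq_mul] at hx
  exact_mod_cast mul_right_cancel₀ hdx hx

/-- A one-letter word is self-avoiding. [folklore] -/
private theorem isSAW_singleton (s : Step) : IsSAW [s] := by
  fin_cases s <;> decide

/-! ### Horizontal steps, cuts, top strands -/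

section Geometry

variable {w : List Step}

/-- A horizontal step keeps the row. [folklore] -/
private theorem trajy_succ_of_isHoriz {t : ℕ} (ht : t < w.length) (h : IsHoriz (st w t)) :
    traj w (t + 1) 1 = traj w t 1 := by
  rw [trajy_succ w ht, dy_of_isHoriz h, add_zero]

/-- A vertical step keeps the column. [folklore] -/
private theorem trajx_succ_of_not_isHoriz {t : ℕ} (ht : t < w.length) (h : ¬ IsHoriz (st w t)) :
    traj w (t + 1) 0 = traj w t 0 := by
  rw [trajx_succ w ht, dx_of_not_isHoriz h, add_zero]

/-- The two columns of a horizontal step are `cutOf` and `cutOf + 1` (rightward or leftward).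
[folklore] -/
private theorem cols_of_isHoriz {t : ℕ} (ht : t < w.length) (h : IsHoriz (st w t)) :
    (traj w t 0 = cutOf w t ∧ traj w (t + 1) 0 = cutOf w t + 1 ∧ Step.dx (st w t) = 1) ∨
    (traj w t 0 = cutOf w t + 1 ∧ traj w (t + 1) 0 = cutOf w t ∧ Step.dx (st w t) = -1) := by
  have hx := trajx_succ w ht
  unfold cutOf
  rcases dx_of_isHoriz h with hd | hd <;> rw [hd] at hx
  · left
    rw [hx, min_eq_left (by linarith)]
    exact ⟨rfl, rfl, hd⟩
  · right
    rw [hx, min_eq_right (by linarith)]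
    exact ⟨by ring, by ring, hd⟩

/-- Two DISTINCT horizontal steps of a self-avoiding word crossing the same cut do so at different
heights (an edge is traversed at most once). [folklore] -/
private theorem heights_ne (hw : IsSAW w) {t t' : ℕ} (ht : t < w.length) (ht' : t' < w.length) (htt' : t ≠ t')
    (h1 : IsHoriz (st w t)) (h2 : IsHoriz (st w t')) (hc : cutOf w t' = cutOf w t) :
    traj w t 1 ≠ traj w t' 1 := by
  rw [isSAW_iff_injOn] at hw
  -- `P_u ∈ {P_v, P_{v+1}}` whenever `u`, `v` cross the same cut at the same height
  have key : ∀ {u v : ℕ}, u < w.length → v < w.length → IsHoriz (st w u) → IsHoriz (st w v) →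
      cutOf w v = cutOf w u → traj w u 1 = traj w v 1 → (u = v ∨ u = v + 1) := by
    intro u v hu hv hhu hhv hcv hyv
    have hyv1 := trajy_succ_of_isHoriz hv hhv
    have hxu : traj w u 0 = cutOf w u ∨ traj w u 0 = cutOf w u + 1 := by
      rcases cols_of_isHoriz hu hhu with ⟨h, -, -⟩ | ⟨h, -, -⟩
      · exact Or.inl h
      · exact Or.inr h
    rcases cols_of_isHoriz hv hhv with ⟨hv0, hv1, -⟩ | ⟨hv0, hv1, -⟩
    · rcases hxu with hxu | hxu
      · left
        exact hw (show u ≤ w.length from hu.le) (show v ≤ w.length from hv.le)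
          (site_ext (by rw [hxu, hv0, hcv]) hyv)
      · right
        exact hw (show u ≤ w.length from hu.le) (show v + 1 ≤ w.length from hv)
          (site_ext (by rw [hxu, hv1, hcv]) (by rw [hyv1, hyv]))
    · rcases hxu with hxu | hxu
      · right
        exact hw (show u ≤ w.length from hu.le) (show v + 1 ≤ w.length from hv)
          (site_ext (by rw [hxu, hv1, hcv]) (by rw [hyv1, hyv]))
      · left
        exact hw (show u ≤ w.length from hu.le) (show v ≤ w.length from hv.le)
          (site_ext (by rw [hxu, hv0, hcv]) hyv)
  intro hy
  rcases key ht ht' h1 h2 hc hy with h | h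
  · exact htt' h
  · rcases key ht' ht h2 h1 hc.symm hy.symm with h' | h'
    · exact htt' h'.symm
    · omega

/-- Membership in `topTimes`. [folklore] -/
private theorem mem_topTimes {t : ℕ} : t ∈ topTimes w ↔ t < w.length ∧ IsTop w t := by
  simp [topTimes]

variable {T : Finset ℕ}

/-- A selected top strand is a step of the word. [folklore] -/
private theorem lt_of_mem (hT : T ⊆ topTimes w) {t : ℕ} (ht : t ∈ T) : t < w.length :=
  (mem_topTimes.1 (hT ht)).1

/-- A selected top strand is horizontal. [folklore] -/
private theorem isHoriz_of_mem (hT : T ⊆ topTimes w) {t : ℕ} (ht : t ∈ T) : IsHoriz (st w t) :=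
  (mem_topTimes.1 (hT ht)).2.2.1

/-- A selected top strand is selected. [folklore] -/
private theorem sel_of_mem (hT : T ⊆ topTimes w) {t : ℕ} (ht : t ∈ T) : Sel w T t :=
  ⟨isHoriz_of_mem hT ht, t, ht, rfl⟩

/-- A selected top strand is at least as high as every step crossing its cut. [folklore] -/
private theorem le_of_mem (hT : T ⊆ topTimes w) {t t' : ℕ} (ht' : t' ∈ T) (ht : t < w.length)
    (hh : IsHoriz (st w t)) (hc : cutOf w t = cutOf w t') : traj w t 1 ≤ traj w t' 1 :=
  (mem_topTimes.1 (hT ht')).2.2.2 t ht hh hc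

/-- Two selected top strands of the same cut coincide. [folklore] -/
private theorem eq_of_mem_of_cut (hw : IsSAW w) (hT : T ⊆ topTimes w) {t₁ t₂ : ℕ} (h₁ : t₁ ∈ T) (h₂ : t₂ ∈ T)
    (hc : cutOf w t₁ = cutOf w t₂) : t₁ = t₂ := by
  by_contra hne
  have hle1 := le_of_mem hT h₂ (lt_of_mem hT h₁) (isHoriz_of_mem hT h₁) hc
  have hle2 := le_of_mem hT h₁ (lt_of_mem hT h₂) (isHoriz_of_mem hT h₂) hc.symm
  exact heights_ne hw (lt_of_mem hT h₁) (lt_of_mem hT h₂) hne (isHoriz_of_mem hT h₁)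
    (isHoriz_of_mem hT h₂) hc.symm (le_antisymm hle1 hle2)

/-- At most one selected top strand per cut. [folklore] -/
private theorem card_filter_cut_le_one (hw : IsSAW w) (hT : T ⊆ topTimes w) (X : ℤ) :
    (T.filter fun t' => cutOf w t' = X).card ≤ 1 :=
  Finset.card_le_one.2 fun _ h₁ _ h₂ =>
    eq_of_mem_of_cut hw hT (mem_filter.1 h₁).1 (mem_filter.1 h₂).1
      ((mem_filter.1 h₁).2.trans (mem_filter.1 h₂).2.symm)

/-- The number of selected top strands of the cut `X` is the indicator of "`X` is selected".
[folklore] -/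
private theorem card_filter_cut_eq (hw : IsSAW w) (hT : T ⊆ topTimes w) (X : ℤ) :
    ((T.filter fun t' => cutOf w t' = X).card : ℤ) = if ∃ t' ∈ T, cutOf w t' = X then 1 else 0 := by
  split_ifs with h
  · have h1 := card_filter_cut_le_one hw hT X
    obtain ⟨t', ht', hc⟩ := h
    have h2 : 0 < (T.filter fun t' => cutOf w t' = X).card :=
      Finset.card_pos.2 ⟨t', mem_filter.2 ⟨ht', hc⟩⟩
    have : (T.filter fun t' => cutOf w t' = X).card = 1 := le_antisymm h1 h2
    exact_mod_cast this
  · have : (T.filter fun t' => cutOf w t' = X).card = 0 := by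
      rw [Finset.card_eq_zero, Finset.filter_eq_empty_iff]
      intro t' ht' hc
      exact h ⟨t', ht', hc⟩
    exact_mod_cast this

/-! ### The column shift `τ` -/

/-- One-column step of `nLeft`. [folklore] -/
private theorem nLeft_add_one (w : List Step) (T : Finset ℕ) (X : ℤ) :
    nLeft w T (X + 1) = nLeft w T X + (T.filter fun t' => cutOf w t' = X).card := by
  unfold nLeft
  rw [← Finset.card_union_of_disjoint]
  · congr 1
    ext t'
    simp only [mem_filter, mem_union]
    constructor
    · rintro ⟨h1, h2⟩
      rcases lt_or_eq_of_le (Int.lt_add_one_iff.1 h2) with h | h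
      · exact Or.inl ⟨h1, h⟩
      · exact Or.inr ⟨h1, h⟩
    · rintro (⟨h1, h2⟩ | ⟨h1, h2⟩)
      · exact ⟨h1, by omega⟩
      · exact ⟨h1, by omega⟩
  · rw [Finset.disjoint_left]
    intro t' h1 h2
    rw [mem_filter] at h1 h2
    omega

/-- One-column step of `τ`. [folklore] -/
private theorem tau_add_one (w : List Step) (T : Finset ℕ) (X : ℤ) :
    tau w T (X + 1) = tau w T X + 1 + 2 * ((T.filter fun t' => cutOf w t' = X).card : ℤ) := by
  unfold tau
  rw [nLeft_add_one]
  push_cast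
  ring

/-- `nLeft` is monotone. [folklore] -/
private theorem nLeft_mono (w : List Step) (T : Finset ℕ) {X Y : ℤ} (h : X ≤ Y) : nLeft w T X ≤ nLeft w T Y := by
  unfold nLeft
  exact card_le_card (fun t' ht' => by
    rw [mem_filter] at ht' ⊢
    exact ⟨ht'.1, lt_of_lt_of_le ht'.2 h⟩)

/-- `τ` is strictly increasing. [folklore] -/
private theorem tau_lt_tau (w : List Step) (T : Finset ℕ) {X Y : ℤ} (h : X < Y) : tau w T X < tau w T Y := by
  unfold tau
  have := nLeft_mono w T h.le
  have : (nLeft w T X : ℤ) ≤ nLeft w T Y := by exact_mod_cast this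
  linarith

/-- `τ` is monotone. [folklore] -/
private theorem tau_le_tau (w : List Step) (T : Finset ℕ) {X Y : ℤ} (h : X ≤ Y) : tau w T X ≤ tau w T Y := by
  rcases eq_or_lt_of_le h with rfl | h
  · exact le_rfl
  · exact (tau_lt_tau w T h).le

/-- `τ` is injective. [folklore] -/
private theorem tau_injective (w : List Step) (T : Finset ℕ) : Function.Injective (tau w T) := by
  intro X Y h
  by_contra hne
  rcases lt_or_gt_of_ne hne with hlt | hlt
  · exact absurd h (tau_lt_tau w T hlt).ne
  · exact absurd h (tau_lt_tau w T hlt).ne'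

/-- Across a selected cut `x` the shift jumps by `3`. [folklore] -/
private theorem tau_selected (hw : IsSAW w) (hT : T ⊆ topTimes w) {x : ℤ} (hx : ∃ t' ∈ T, cutOf w t' = x) :
    tau w T (x + 1) = tau w T x + 3 := by
  rw [tau_add_one, card_filter_cut_eq hw hT, if_pos hx]
  ring

/-- Across an unselected cut the shift jumps by `1`. [folklore] -/
private theorem tau_unselected (hw : IsSAW w) (hT : T ⊆ topTimes w) {x : ℤ} (hx : ¬ ∃ t' ∈ T, cutOf w t' = x) :
    tau w T (x + 1) = tau w T x + 1 := by
  rw [tau_add_one, card_filter_cut_eq hw hT, if_neg hx]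
  ring

/-- The two inserted columns of a selected cut are not image columns. [folklore] -/
private theorem tau_ne_inserted (hw : IsSAW w) (hT : T ⊆ topTimes w) {x : ℤ} (hx : ∃ t' ∈ T, cutOf w t' = x)
    (X : ℤ) {e : ℤ} (he : e = 1 ∨ e = 2) : tau w T X ≠ tau w T x + e := by
  rcases le_or_gt X x with h | h
  · have := tau_le_tau w T h
    rcases he with rfl | rfl <;> linarith
  · have h1 : x + 1 ≤ X := by omega
    have := tau_le_tau w T h1
    rw [tau_selected hw hT hx] at this
    rcases he with rfl | rfl <;> linarith

/-- Inserted columns of different selected cuts are different. [folklore] -/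
private theorem inserted_ne_inserted (hw : IsSAW w) (hT : T ⊆ topTimes w) {x x' : ℤ}
    (hx : ∃ t' ∈ T, cutOf w t' = x) (hx' : ∃ t' ∈ T, cutOf w t' = x') (hne : x ≠ x')
    {e e' : ℤ} (he : e = 1 ∨ e = 2) (he' : e' = 1 ∨ e' = 2) :
    tau w T x + e ≠ tau w T x' + e' := by
  wlog hlt : x < x' generalizing x x' e e'
  · intro h
    exact this hx' hx hne.symm he' he (lt_of_le_of_ne (not_lt.1 hlt) hne.symm) h.symm
  have h1 : x + 1 ≤ x' := by omega
  have := tau_le_tau w T h1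
  rw [tau_selected hw hT hx] at this
  rcases he with rfl | rfl <;> rcases he' with rfl | rfl <;> linarith

end Geometry

/-! ### The image of the original vertices -/

/-- The image of the `i`-th vertex of `w`: same row, shifted column (normalised to start at the
origin). [folklore] -/
private def img (w : List Step) (T : Finset ℕ) (i : ℕ) : Site 2 :=
  ![tau w T (traj w i 0) - tau w T 0, traj w i 1]

/-- Column of the image vertex. [folklore] -/
@[simp] private theorem img_apply_zero (w : List Step) (T : Finset ℕ) (i : ℕ) :
    img w T i 0 = tau w T (traj w i 0) - tau w T 0 := rfl

/-- Row of the image vertex. [folklore] -/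
@[simp] private theorem img_apply_one (w : List Step) (T : Finset ℕ) (i : ℕ) : img w T i 1 = traj w i 1 := rfl

/-- The image walk starts at the origin. [folklore] -/
private theorem img_zero (w : List Step) (T : Finset ℕ) : img w T 0 = 0 :=
  site_ext (by simp) (by simp)

section Image

variable {L : ℕ} {a : ℤ} {w : List Step} {T : Finset ℕ}

/-- For a horizontal step, being selected means "its cut is selected". [folklore] -/
private theorem sel_iff {t : ℕ} (hh : IsHoriz (st w t)) : (t ∈ T ∨ Sel w T t) ↔ ∃ t' ∈ T, cutOf w t' = cutOf w t := by
  constructor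
  · rintro (h | h)
    · exact ⟨t, h, rfl⟩
    · exact h.2
  · intro h
    exact Or.inr ⟨hh, h⟩

/-- One step of the image walk is the displacement of the corresponding block. [folklore] -/
private theorem img_succ (hw : IsSAW w) (hT : T ⊆ topTimes w) {t : ℕ} (ht : t < w.length) :
    img w T (t + 1) = img w T t + wEnd (rep L a w T t) := by
  rw [wEnd_rep]
  by_cases hh : IsHoriz (st w t)
  · have hy := trajy_succ_of_isHoriz ht hh
    rcases cols_of_isHoriz ht hh with ⟨h0, h1, hd⟩ | ⟨h0, h1, hd⟩
    · -- a step to the right across the cut `x_t`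
      by_cases hs : ∃ t' ∈ T, cutOf w t' = cutOf w t
      · rw [if_pos ((sel_iff hh).2 hs)]
        refine site_ext ?_ ?_
        · simp only [img_apply_zero, Pi.add_apply, Pi.smul_apply, Step.vec_apply_zero, h0, h1, hd,
            tau_selected hw hT hs]
          ring
        · simp [hy, dy_of_isHoriz hh]
      · rw [if_neg (fun h => hs ((sel_iff hh).1 h))]
        refine site_ext ?_ ?_
        · simp only [img_apply_zero, Pi.add_apply, Step.vec_apply_zero, h0, h1, hd,
            tau_unselected hw hT hs]
          ring
        · simp [hy, dy_of_isHoriz hh]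
    · -- a step to the left across the cut `x_t - 1`
      by_cases hs : ∃ t' ∈ T, cutOf w t' = cutOf w t
      · rw [if_pos ((sel_iff hh).2 hs)]
        refine site_ext ?_ ?_
        · simp only [img_apply_zero, Pi.add_apply, Pi.smul_apply, Step.vec_apply_zero, h0, h1, hd,
            tau_selected hw hT hs]
          ring
        · simp [hy, dy_of_isHoriz hh]
      · rw [if_neg (fun h => hs ((sel_iff hh).1 h))]
        refine site_ext ?_ ?_
        · simp only [img_apply_zero, Pi.add_apply, Step.vec_apply_zero, h0, h1, hd,
            tau_unselected hw hT hs]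
          ring
        · simp [hy, dy_of_isHoriz hh]
  · -- a vertical step: not selected
    have hnT : t ∉ T := fun h => hh (isHoriz_of_mem hT h)
    have hns : ¬ Sel w T t := fun h => hh h.1
    rw [if_neg (by tauto)]
    refine site_ext ?_ ?_
    · simp [trajx_succ_of_not_isHoriz ht hh, dx_of_not_isHoriz hh]
    · simp [trajy_succ w ht]

/-- **The displacement of the first `t` blocks is the image of the `t`-th vertex.** [folklore] -/
private theorem bend_rep (hw : IsSAW w) (hT : T ⊆ topTimes w) :
    ∀ t ≤ w.length, bend (rep L a w T) t = img w T t := by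
  intro t
  induction t with
  | zero => intro; rw [bend_zero, img_zero]
  | succ t ih =>
    intro ht
    rw [bend_succ, ih (by omega), img_succ hw hT (by omega)]

/-- The image walk is injective on `[0, n]`. [folklore] -/
private theorem img_injOn (hw : IsSAW w) : Set.InjOn (img w T) {i | i ≤ w.length} := by
  intro i hi i' hi' h
  rw [isSAW_iff_injOn] at hw
  refine hw hi hi' (site_ext ?_ ?_)
  · have := congrFun h 0
    simp only [img_apply_zero] at this
    exact tau_injective w T (by linarith)
  · simpa using congrFun h 1

/-! ### The vertices of `Ψ` -/

/-- `V t r`: the `r`-th vertex of block `t` of `Ψ`. [folklore] -/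
private def V (L : ℕ) (a : ℤ) (w : List Step) (T : Finset ℕ) (t r : ℕ) : Site 2 :=
  img w T t + traj (rep L a w T t) r

/-- The trajectory of `Ψ` in block coordinates. [folklore] -/
private theorem traj_Psi (hw : IsSAW w) (hT : T ⊆ topTimes w) {t r : ℕ} (ht : t < w.length)
    (hr : r ≤ (rep L a w T t).length) :
    traj (Psi L a w T) (blen (rep L a w T) t + r) = V L a w T t r := by
  rw [Psi, traj_blocks _ ht hr, bend_rep hw hT t ht.le, V]

/-- The endpoint of `Ψ`. [folklore] -/
private theorem traj_Psi_end (hw : IsSAW w) (hT : T ⊆ topTimes w) :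
    traj (Psi L a w T) (blen (rep L a w T) w.length) = img w T w.length := by
  rw [Psi, ← length_blocks, traj_length, wEnd_blocks, bend_rep hw hT _ le_rfl]

/-- Length of `Ψ`. [folklore] -/
private theorem length_Psi : (Psi L a w T).length = blen (rep L a w T) w.length := length_blocks _ _

/-- An inner vertex (`1 ≤ r < |block|`) of block `t` exists only for selected steps. [folklore] -/
private theorem sel_of_inner (hT : T ⊆ topTimes w) {t r : ℕ} (hr1 : 1 ≤ r) (hr : r < (rep L a w T t).length) :
    Sel w T t := by
  rw [length_rep] at hr
  split_ifs at hr with h1 h2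
  · exact sel_of_mem hT h1
  · exact h2
  · omega

/-- **Position of an inner vertex**: it lies in one of the two inserted columns of its cut, at a
row `≥` the row of its strand, equal to it for a stretched (non-top) strand, and `≤` the top of
the excursion. [folklore] -/
private theorem inner_pos (hw : IsSAW w) (hT : T ⊆ topTimes w) {t r : ℕ} (ht : t < w.length) (hr1 : 1 ≤ r)
    (hr : r < (rep L a w T t).length) :
    (V L a w T t r 0 = tau w T (cutOf w t) + 1 - tau w T 0 ∨
      V L a w T t r 0 = tau w T (cutOf w t) + 2 - tau w T 0) ∧
    traj w t 1 ≤ V L a w T t r 1 ∧ (t ∉ T → V L a w T t r 1 = traj w t 1) ∧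
    V L a w T t r 1 ≤ traj w t 1 + exc L a w t := by
  have hsel := sel_of_inner hT hr1 hr
  have hh : IsHoriz (st w t) := hsel.1
  have hdy := dy_of_isHoriz hh
  have hcut : ∃ t' ∈ T, cutOf w t' = cutOf w t := hsel.2
  -- the position inside the block: `c • vec s + i • e₁`
  obtain ⟨c, i, hc, hi, hiT, hpos⟩ : ∃ c i : ℕ, (c = 1 ∨ c = 2) ∧ i ≤ exc L a w t ∧ (t ∉ T → i = 0) ∧
      traj (rep L a w T t) r = c • Step.vec (st w t) + i • Step.vec 1 := by
    by_cases h1 : t ∈ T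
    · have hr' : r ≤ 2 * exc L a w t + 2 := by rw [length_rep, if_pos h1] at hr; omega
      obtain ⟨c, i, hc, hi, hpos⟩ := traj_excWord_mid (st w t) (exc L a w t) hr1 hr'
      exact ⟨c, i, hc, hi, fun h => absurd h1 h, by rw [rep, if_pos h1, hpos]⟩
    · have hr' : r ≤ 2 := by rw [length_rep, if_neg h1, if_pos hsel] at hr; simpa using Nat.le_of_lt_succ hr
      refine ⟨r, 0, by omega, Nat.zero_le _, fun _ => rfl, ?_⟩
      rw [rep, if_neg h1, if_pos hsel, show [st w t, st w t] ++ [st w t] = List.replicate 3 (st w t) ++ []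
        from rfl, traj_replicate_le _ (by omega), zero_nsmul, add_zero]
  have hx : V L a w T t r 0 = tau w T (traj w t 0) - tau w T 0 + c * Step.dx (st w t) := by
    rw [V, Pi.add_apply, hpos, smul_vec_add_apply_zero, img_apply_zero]
  have hy : V L a w T t r 1 = traj w t 1 + i := by
    rw [V, Pi.add_apply, hpos, smul_vec_add_apply_one, img_apply_one, hdy, mul_zero, zero_add]
  have hi' : (i : ℤ) ≤ exc L a w t := by exact_mod_cast hi
  refine ⟨?_, by rw [hy]; linarith, fun h => by rw [hy, hiT h]; simp, by rw [hy]; linarith⟩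
  rcases cols_of_isHoriz ht hh with ⟨h0, -, hd⟩ | ⟨h0, -, hd⟩
  · rw [hx, h0, hd]
    rcases hc with rfl | rfl
    · left; push_cast; ring
    · right; push_cast; ring
  · rw [hx, h0, hd, tau_selected hw hT hcut]
    rcases hc with rfl | rfl
    · right; push_cast; ring
    · left; push_cast; ring

/-- Each block is a self-avoiding word. [folklore] -/
private theorem isSAW_rep (hT : T ⊆ topTimes w) (t : ℕ) : IsSAW (rep L a w T t) := by
  unfold rep
  split_ifs with h1 h2
  · exact isSAW_excWord (isHoriz_of_mem hT h1) _
  · exact isSAW_triple h2.1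
  · exact isSAW_singleton _

/-- **`Ψ(w, T)` is self-avoiding** (for `w` self-avoiding and `T` a set of top strands).
[folklore] -/
private theorem isSAW_Psi (hw : IsSAW w) (hT : T ⊆ topTimes w) : IsSAW (Psi L a w T) := by
  rw [isSAW_iff_injOn]
  set F := rep L a w T with hF
  -- normal form of a time `i ≤ |Ψ|`
  have nf : ∀ i ≤ blen F w.length, ∃ t r, i = blen F t + r ∧ t ≤ w.length ∧
      ((t < w.length ∧ r < (F t).length) ∨ (t = w.length ∧ r = 0)) := by
    intro i hi
    rcases lt_or_eq_of_le hi with hi | hi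
    · obtain ⟨t, ht, r, hr, rfl⟩ := exists_block F w.length i hi
      exact ⟨t, r, rfl, ht.le, Or.inl ⟨ht, hr⟩⟩
    · exact ⟨w.length, 0, by rw [hi, add_zero], le_rfl, Or.inr ⟨rfl, rfl⟩⟩
  -- value at a normal form
  have val : ∀ t r, t ≤ w.length → ((t < w.length ∧ r < (F t).length) ∨ (t = w.length ∧ r = 0)) →
      traj (Psi L a w T) (blen F t + r) = V L a w T t r := by
    rintro t r - (⟨ht, hr⟩ | ⟨rfl, rfl⟩)
    · exact traj_Psi hw hT ht hr.le
    · rw [add_zero, traj_Psi_end hw hT, V, traj_zero, add_zero]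
  -- column of an image vertex vs an inner vertex
  have col_img : ∀ t, V L a w T t 0 0 = tau w T (traj w t 0) - tau w T 0 := fun t => by
    simp [V]
  intro i hi i' hi' heq
  simp only [Set.mem_setOf_eq, length_Psi] at hi hi'
  obtain ⟨t, r, rfl, htn, hnr⟩ := nf i hi
  obtain ⟨t', r', rfl, htn', hnr'⟩ := nf i' hi'
  rw [val t r htn hnr, val t' r' htn' hnr'] at heq
  -- Case analysis on `r = 0` / `r ≥ 1`
  rcases Nat.eq_zero_or_pos r with hr0 | hr0 <;> rcases Nat.eq_zero_or_pos r' with hr0' | hr0'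
  · -- two image vertices
    subst hr0; subst hr0'
    have : img w T t = img w T t' := by simpa [V] using heq
    rw [img_injOn hw htn htn' this]
  · -- image vertex = inner vertex: impossible (columns)
    exfalso
    subst hr0
    have ht' : t' < w.length := by rcases hnr' with ⟨h, -⟩ | ⟨-, h⟩ <;> omega
    have hr' : r' < (F t').length := by rcases hnr' with ⟨-, h⟩ | ⟨-, h⟩ <;> omega
    obtain ⟨hcol, -⟩ := inner_pos hw hT ht' hr0' hr'
    have hsel := sel_of_inner (L := L) (a := a) hT hr0' hr'
    have h0 := congrFun heq 0
    rw [col_img] at h0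
    rcases hcol with h | h <;> rw [h] at h0
    · exact tau_ne_inserted hw hT hsel.2 (traj w t 0) (Or.inl rfl) (by linarith)
    · exact tau_ne_inserted hw hT hsel.2 (traj w t 0) (Or.inr rfl) (by linarith)
  · exfalso
    subst hr0'
    have ht : t < w.length := by rcases hnr with ⟨h, -⟩ | ⟨-, h⟩ <;> omega
    have hr : r < (F t).length := by rcases hnr with ⟨-, h⟩ | ⟨-, h⟩ <;> omega
    obtain ⟨hcol, -⟩ := inner_pos hw hT ht hr0 hr
    have hsel := sel_of_inner (L := L) (a := a) hT hr0 hr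
    have h0 := congrFun heq 0
    rw [col_img] at h0
    rcases hcol with h | h <;> rw [h] at h0
    · exact tau_ne_inserted hw hT hsel.2 (traj w t' 0) (Or.inl rfl) (by linarith)
    · exact tau_ne_inserted hw hT hsel.2 (traj w t' 0) (Or.inr rfl) (by linarith)
  · -- two inner vertices
    have ht : t < w.length := by rcases hnr with ⟨h, -⟩ | ⟨-, h⟩ <;> omega
    have hr : r < (F t).length := by rcases hnr with ⟨-, h⟩ | ⟨-, h⟩ <;> omega
    have ht' : t' < w.length := by rcases hnr' with ⟨h, -⟩ | ⟨-, h⟩ <;> omega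
    have hr' : r' < (F t').length := by rcases hnr' with ⟨-, h⟩ | ⟨-, h⟩ <;> omega
    obtain ⟨hcol, hyle, hyeq, -⟩ := inner_pos hw hT ht hr0 hr
    obtain ⟨hcol', hyle', hyeq', -⟩ := inner_pos hw hT ht' hr0' hr'
    have hsel := sel_of_inner (L := L) (a := a) hT hr0 hr
    have hsel' := sel_of_inner (L := L) (a := a) hT hr0' hr'
    have h0 := congrFun heq 0
    have h1 := congrFun heq 1
    -- same cut
    have hcut : cutOf w t = cutOf w t' := by
      by_contra hne
      rcases hcol with h | h <;> rcases hcol' with h' | h' <;> rw [h, h'] at h0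
      · exact inserted_ne_inserted hw hT hsel.2 hsel'.2 hne (Or.inl rfl) (Or.inl rfl) (by linarith)
      · exact inserted_ne_inserted hw hT hsel.2 hsel'.2 hne (Or.inl rfl) (Or.inr rfl) (by linarith)
      · exact inserted_ne_inserted hw hT hsel.2 hsel'.2 hne (Or.inr rfl) (Or.inl rfl) (by linarith)
      · exact inserted_ne_inserted hw hT hsel.2 hsel'.2 hne (Or.inr rfl) (Or.inr rfl) (by linarith)
    by_cases htt : t = t'
    · -- same block: the block is self-avoiding
      subst htt
      have hinj := (isSAW_iff_injOn _).1 (isSAW_rep (L := L) (a := a) hT t)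
      have : traj (F t) r = traj (F t) r' := by
        have := heq; simp only [V] at this; exact add_left_cancel this
      rw [hinj (show r ≤ (F t).length from hr.le) (show r' ≤ (F t).length from hr'.le) this]
    · exfalso
      have hyne := heights_ne hw ht ht' htt hsel.1 hsel'.1 hcut.symm
      by_cases h1T : t ∈ T <;> by_cases h1T' : t' ∈ T
      · exact htt (eq_of_mem_of_cut hw hT h1T h1T' hcut)
      · have e' := hyeq' h1T'
        have hle := le_of_mem hT h1T ht' hsel'.1 hcut.symm
        have : V L a w T t r 1 = V L a w T t' r' 1 := h1
        have hlt : traj w t' 1 < traj w t 1 := lt_of_le_of_ne hle hyne.symm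
        linarith
      · have e := hyeq h1T
        have hle := le_of_mem hT h1T' ht hsel.1 hcut
        have : V L a w T t r 1 = V L a w T t' r' 1 := h1
        have hlt : traj w t 1 < traj w t' 1 := lt_of_le_of_ne hle hyne
        linarith
      · have e := hyeq h1T
        have e' := hyeq' h1T'
        have : V L a w T t r 1 = V L a w T t' r' 1 := h1
        exact hyne (by linarith)

end Image

/-! ### Decoding: the kept positions of `Ψ` and injectivity of `(w, T) ↦ Ψ(w, T)` -/

section Decode

variable {L : ℕ} {a : ℤ} {w : List Step} {T : Finset ℕ}

/-- `w` stays in the rows `-a, …, L - a` (the word of a walk in the strip `ℤ × {0,…,L}` started at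
height `a`). A decidable predicate, not a named fact. [folklore] -/
private def InStrip (L : ℕ) (a : ℤ) (w : List Step) : Prop :=
  ∀ i ≤ w.length, 0 ≤ a + traj w i 1 ∧ a + traj w i 1 ≤ L

/-- The excursion height is positive and reaches the row `L + 1 - a` exactly. [folklore] -/
private theorem exc_spec (hs : InStrip L a w) {t : ℕ} (ht : t ≤ w.length) :
    (exc L a w t : ℤ) = L + 1 - a - traj w t 1 ∧ 1 ≤ exc L a w t := by
  have h := (hs t ht).2
  have e : (exc L a w t : ℤ) = L + 1 - a - traj w t 1 := by
    rw [exc, Int.toNat_of_nonneg (by linarith)]; ring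
  refine ⟨e, ?_⟩
  have : (1 : ℤ) ≤ exc L a w t := by rw [e]; linarith
  exact_mod_cast this

/-- A position `i < |W|` is **kept** when the vertex reached by the `i`-th step lies in a column
containing NO vertex at (relative) row `L + 1 - a`. A decidable predicate, not a named fact.
[folklore] -/
private def IsKept (L : ℕ) (a : ℤ) (W : List Step) (i : ℕ) : Prop :=
  i < W.length ∧ ¬ ∃ i' ≤ W.length, traj W i' 0 = traj W (i + 1) 0 ∧ traj W i' 1 = L + 1 - a

/-- The two inserted columns of a selected cut contain a top vertex of the excursion. [folklore] -/
private theorem exists_top_vertex (hw : IsSAW w) (hT : T ⊆ topTimes w) (hs : InStrip L a w) {c : ℤ}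
    (hc : ∃ t' ∈ T, cutOf w t' = c) {e : ℤ} (he : e = 1 ∨ e = 2) :
    ∃ i ≤ (Psi L a w T).length, traj (Psi L a w T) i 0 = tau w T c + e - tau w T 0 ∧
      traj (Psi L a w T) i 1 = L + 1 - a := by
  obtain ⟨t, htT, rfl⟩ := hc
  have ht := lt_of_mem hT htT
  have hh := isHoriz_of_mem hT htT
  have hdy := dy_of_isHoriz hh
  set j := exc L a w t with hj
  obtain ⟨hjeq, -⟩ := exc_spec hs ht.le
  have hrep : rep L a w T t = excWord (st w t) j := by rw [rep, if_pos htT]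
  have hlen : (rep L a w T t).length = 2 * j + 3 := by rw [hrep, length_excWord]
  -- the two top vertices: after `1 + j` steps (column `img + dx`) and after `j + 2` steps (`img + 2dx`)
  have hup : V L a w T t (1 + j) = img w T t + (1 • Step.vec (st w t) + j • Step.vec 1) := by
    rw [V, hrep, traj_excWord_up _ _ le_rfl]
  have hdown : V L a w T t (j + 2) = img w T t + (2 • Step.vec (st w t) + j • Step.vec 1) := by
    rw [V, hrep, show j + 2 = j + 2 + 0 by rfl, traj_excWord_down _ _ (Nat.zero_le _), Nat.sub_zero]
  have yup : V L a w T t (1 + j) 1 = L + 1 - a := by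
    rw [hup, Pi.add_apply, smul_vec_add_apply_one, img_apply_one, hdy]; push_cast; linarith
  have ydown : V L a w T t (j + 2) 1 = L + 1 - a := by
    rw [hdown, Pi.add_apply, smul_vec_add_apply_one, img_apply_one, hdy]; push_cast; linarith
  have xup : V L a w T t (1 + j) 0 = tau w T (traj w t 0) - tau w T 0 + Step.dx (st w t) := by
    rw [hup, Pi.add_apply, smul_vec_add_apply_zero, img_apply_zero]; push_cast; ring
  have xdown : V L a w T t (j + 2) 0 = tau w T (traj w t 0) - tau w T 0 + 2 * Step.dx (st w t) := by
    rw [hdown, Pi.add_apply, smul_vec_add_apply_zero, img_apply_zero]; push_cast; ring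
  have tup := traj_Psi hw hT ht (show 1 + j ≤ (rep L a w T t).length by rw [hlen]; omega)
  have tdown := traj_Psi hw hT ht (show j + 2 ≤ (rep L a w T t).length by rw [hlen]; omega)
  have hb := blen_mono (rep L a w T) (show t + 1 ≤ w.length by omega)
  rw [blen_succ, hlen] at hb
  have bup : blen (rep L a w T) t + (1 + j) ≤ (Psi L a w T).length := by
    rw [length_Psi]; omega
  have bdown : blen (rep L a w T) t + (j + 2) ≤ (Psi L a w T).length := by
    rw [length_Psi]; omega
  have hsel : ∃ t' ∈ T, cutOf w t' = cutOf w t := ⟨t, htT, rfl⟩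
  rcases cols_of_isHoriz ht hh with ⟨h0, -, hd⟩ | ⟨h0, -, hd⟩
  · rcases he with rfl | rfl
    · exact ⟨_, bup, by rw [tup, xup, h0, hd]; ring, by rw [tup, yup]⟩
    · exact ⟨_, bdown, by rw [tdown, xdown, h0, hd]; ring, by rw [tdown, ydown]⟩
  · rcases he with rfl | rfl
    · exact ⟨_, bdown, by rw [tdown, xdown, h0, hd, tau_selected hw hT hsel]; ring, by rw [tdown, ydown]⟩
    · exact ⟨_, bup, by rw [tup, xup, h0, hd, tau_selected hw hT hsel]; ring, by rw [tup, yup]⟩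

/-- No vertex of `Ψ` in an image column lies at row `L + 1 - a`. [folklore] -/
private theorem no_top_in_image_col (hw : IsSAW w) (hT : T ⊆ topTimes w) (hs : InStrip L a w) (X : ℤ) :
    ¬ ∃ i ≤ (Psi L a w T).length, traj (Psi L a w T) i 0 = tau w T X - tau w T 0 ∧
      traj (Psi L a w T) i 1 = L + 1 - a := by
  rintro ⟨i, hi, hx, hy⟩
  rw [length_Psi] at hi
  rcases lt_or_eq_of_le hi with hi | hi
  · obtain ⟨t, ht, r, hr, rfl⟩ := exists_block _ _ i hi
    rw [traj_Psi hw hT ht hr.le] at hx hy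
    rcases Nat.eq_zero_or_pos r with rfl | hr0
    · simp only [V, traj_zero, add_zero, img_apply_one] at hy
      have := (hs t ht.le).2
      linarith
    · obtain ⟨hcol, -⟩ := inner_pos hw hT ht hr0 hr
      have hsel := (sel_of_inner (L := L) (a := a) hT hr0 hr).2
      rcases hcol with h | h <;> rw [h] at hx
      · exact tau_ne_inserted hw hT hsel X (Or.inl rfl) (by linarith)
      · exact tau_ne_inserted hw hT hsel X (Or.inr rfl) (by linarith)
  · rw [hi, traj_Psi_end hw hT, img_apply_one] at hy
    have := (hs w.length le_rfl).2
    linarith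

/-- **The kept positions of `Ψ(w,T)` are exactly the last steps of the blocks.** [folklore] -/
private theorem isKept_Psi_iff (hw : IsSAW w) (hT : T ⊆ topTimes w) (hs : InStrip L a w) (i : ℕ) :
    IsKept L a (Psi L a w T) i ↔ ∃ t < w.length, i + 1 = blen (rep L a w T) (t + 1) := by
  constructor
  · rintro ⟨hi, hno⟩
    rw [length_Psi] at hi
    obtain ⟨t, ht, r, hr, rfl⟩ := exists_block _ _ i hi
    refine ⟨t, ht, ?_⟩
    rw [blen_succ]
    by_contra hne
    have hr1 : r + 1 < (rep L a w T t).length := by omega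
    apply hno
    -- the next vertex is an inner vertex: its column is inserted
    have hnext : traj (Psi L a w T) (blen (rep L a w T) t + r + 1) = V L a w T t (r + 1) := by
      rw [add_assoc, traj_Psi hw hT ht hr1.le]
    obtain ⟨hcol, -⟩ := inner_pos hw hT ht (by omega) hr1
    have hsel := (sel_of_inner (L := L) (a := a) hT (by omega) hr1).2
    rcases hcol with h | h
    · obtain ⟨i', hi', hx', hy'⟩ := exists_top_vertex hw hT hs hsel (Or.inl rfl)
      exact ⟨i', hi', by rw [hnext, h, hx'], hy'⟩
    · obtain ⟨i', hi', hx', hy'⟩ := exists_top_vertex hw hT hs hsel (Or.inr rfl)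
      exact ⟨i', hi', by rw [hnext, h, hx'], hy'⟩
  · rintro ⟨t, ht, hi⟩
    have hpos := length_rep_pos L a w T t
    refine ⟨?_, ?_⟩
    · rw [length_Psi]
      have := blen_mono (rep L a w T) (show t + 1 ≤ w.length by omega)
      omega
    · have hnext : traj (Psi L a w T) (i + 1) = img w T (t + 1) := by
        rw [hi, blen_succ, traj_Psi hw hT ht le_rfl, V, traj_length, ← img_succ hw hT ht]
      rw [hnext, img_apply_zero]
      exact no_top_in_image_col hw hT hs _

/-- Uniqueness of the increasing enumeration of a set of naturals. [folklore] -/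
private theorem enum_unique {P : ℕ → Prop} {g g' : ℕ → ℕ} {n : ℕ} (hg : StrictMono g) (hg' : StrictMono g')
    (h : ∀ i, P i ↔ ∃ t < n, i = g t) (h' : ∀ i, P i ↔ ∃ t < n, i = g' t) : ∀ t < n, g t = g' t := by
  intro t
  induction t using Nat.strong_induction_on with
  | _ t ih =>
    intro ht
    obtain ⟨u, hu, hgu⟩ := (h' (g t)).1 ((h (g t)).2 ⟨t, ht, rfl⟩)
    obtain ⟨u', hu', hgu'⟩ := (h (g' t)).1 ((h' (g' t)).2 ⟨t, ht, rfl⟩)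
    rcases lt_trichotomy u t with hlt | rfl | hgt
    · exfalso
      rw [← ih u hlt hu] at hgu
      exact absurd hgu (hg hlt).ne'
    · exact hgu
    · rcases lt_trichotomy u' t with hlt' | rfl | hgt'
      · exfalso
        rw [ih u' hlt' hu'] at hgu'
        exact absurd hgu' (hg' hlt').ne'
      · exact hgu'.symm
      · exfalso
        have h1 := hg' hgt   -- g' t < g' u = g t
        have h2 := hg hgt'   -- g t < g u' = g' t
        rw [← hgu] at h1
        rw [← hgu'] at h2
        exact absurd (h1.trans h2) (lt_irrefl _)

/-- The block boundaries of `Ψ` as a strictly increasing function. [folklore] -/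
private theorem strictMono_blen (F : ℕ → List Step) (hF : ∀ t, 0 < (F t).length) :
    StrictMono fun t => blen F (t + 1) - 1 := by
  refine strictMono_nat_of_lt_succ fun t => ?_
  have h1 := blen_succ F (t + 1)
  have h2 := blen_succ F t
  have := hF t
  have := hF (t + 1)
  show blen F (t + 1) - 1 < blen F (t + 1 + 1) - 1
  omega

/-- **Injectivity of the insertion**: for strip words of the same length, `Ψ(w,T) = Ψ(w',T')`
forces `w = w'` and `T = T'`. [folklore] -/
private theorem Psi_injective {w' : List Step} {T' : Finset ℕ} (hw : IsSAW w) (hT : T ⊆ topTimes w)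
    (hs : InStrip L a w) (hw' : IsSAW w') (hT' : T' ⊆ topTimes w') (hs' : InStrip L a w')
    (hlen : w.length = w'.length) (h : Psi L a w T = Psi L a w' T') : w = w' ∧ T = T' := by
  -- the block boundaries coincide
  have hg : ∀ t < w.length, blen (rep L a w T) (t + 1) - 1 = blen (rep L a w' T') (t + 1) - 1 := by
    refine enum_unique (P := IsKept L a (Psi L a w T))
      (strictMono_blen (rep L a w T) (length_rep_pos L a w T))
      (strictMono_blen (rep L a w' T') (length_rep_pos L a w' T')) (fun i => ?_) (fun i => ?_)
    · rw [isKept_Psi_iff hw hT hs]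
      constructor
      · rintro ⟨t, ht, hi⟩
        exact ⟨t, ht, by omega⟩
      · rintro ⟨t, ht, hi⟩
        have h1 := length_rep_pos L a w T t
        have h2 := blen_succ (rep L a w T) t
        exact ⟨t, ht, by omega⟩
    · rw [h, isKept_Psi_iff hw' hT' hs', ← hlen]
      constructor
      · rintro ⟨t, ht, hi⟩
        exact ⟨t, ht, by omega⟩
      · rintro ⟨t, ht, hi⟩
        have h1 := length_rep_pos L a w' T' t
        have h2 := blen_succ (rep L a w' T') t
        exact ⟨t, ht, by omega⟩
  have hblen : ∀ t ≤ w.length, blen (rep L a w T) t = blen (rep L a w' T') t := by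
    intro t ht
    induction t with
    | zero => rw [blen_zero, blen_zero]
    | succ t _ =>
      have h1 := hg t (by omega)
      have p1 := length_rep_pos L a w T t
      have p2 := length_rep_pos L a w' T' t
      have b1 := blen_succ (rep L a w T) t
      have b2 := blen_succ (rep L a w' T') t
      omega
  have hlenF : ∀ t < w.length, (rep L a w T t).length = (rep L a w' T' t).length := by
    intro t ht
    have h1 := hblen t ht.le
    have h2 := hblen (t + 1) ht
    rw [blen_succ, blen_succ] at h2
    omega
  -- the letters coincide
  have hst : ∀ t < w.length, st w t = st w' t := by
    intro t ht
    have ht' : t < w'.length := hlen ▸ ht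
    have p1 := length_rep_pos L a w T t
    have p2 := length_rep_pos L a w' T' t
    have e1 := getElem?_blocks (rep L a w T) ht
      (show (rep L a w T t).length - 1 < (rep L a w T t).length by omega)
    have e2 := getElem?_blocks (rep L a w' T') ht'
      (show (rep L a w' T' t).length - 1 < (rep L a w' T' t).length by omega)
    rw [getLast_rep] at e1 e2
    have hPsi : blocks (rep L a w' T') w'.length = blocks (rep L a w T) w.length := h.symm
    rw [hPsi, ← hlenF t ht, ← hblen t ht.le, e1] at e2
    exact Option.some_injective _ e2
  have hww : w = w' := by
    apply List.ext_getElem hlen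
    intro t h1 h2
    rw [← st_eq_getElem w h1, ← st_eq_getElem w' h2, hst t h1]
  subst hww
  refine ⟨rfl, ?_⟩
  -- the selected top strands coincide: `t ∈ T` iff its block has length `≥ 5`
  have key : ∀ {T₁ T₂ : Finset ℕ}, T₁ ⊆ topTimes w → (∀ t < w.length,
      (rep L a w T₁ t).length = (rep L a w T₂ t).length) → T₁ ⊆ T₂ := by
    intro T₁ T₂ h₁ hl t ht
    have htn := lt_of_mem h₁ ht
    have e := hl t htn
    obtain ⟨-, hj⟩ := exc_spec hs htn.le
    rw [length_rep, if_pos ht, length_rep] at e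
    by_contra hnot
    rw [if_neg hnot] at e
    split_ifs at e <;> omega
  exact Finset.Subset.antisymm (key hT hlenF) (key hT' fun t ht => (hlenF t ht).symm)

end Decode

/-! ### Pigeonhole: a strip word crosses at least `(n+1)/(L+1) - 1` cuts -/

section Pigeonhole

variable {L : ℕ} {a : ℤ} {w : List Step}

/-- `dx ∈ {-1, 0, 1}`. [folklore] -/
private theorem dx_le_one (s : Step) : Step.dx s ≤ 1 ∧ -1 ≤ Step.dx s := by
  fin_cases s <;> simp [Step.dx]

/-- A step with `dx ≠ 0` is horizontal. [folklore] -/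
private theorem isHoriz_of_dx_ne_zero {s : Step} (h : Step.dx s ≠ 0) : IsHoriz s := by
  by_contra h'
  exact h (dx_of_not_isHoriz h')

/-- Discrete intermediate value, rightwards: a walk that is at column `≤ x` at time `i₀` and at
column `≥ x + 1` at a later time `i₁ ≤ n` crosses the cut `x`. [folklore] -/
private theorem exists_cross_right {i₀ i₁ : ℕ} (hi : i₀ < i₁) (hi₁ : i₁ ≤ w.length) {x : ℤ}
    (h0 : traj w i₀ 0 ≤ x) (h1 : x + 1 ≤ traj w i₁ 0) :
    ∃ t < w.length, IsHoriz (st w t) ∧ cutOf w t = x := by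
  classical
  have hex : ∃ i, i₀ < i ∧ x + 1 ≤ traj w i 0 := ⟨i₁, hi, h1⟩
  have hm := Nat.find_spec hex
  have hm_le : Nat.find hex ≤ i₁ := Nat.find_min' hex ⟨hi, h1⟩
  obtain ⟨k, hk⟩ : ∃ k, Nat.find hex = k + 1 := ⟨Nat.find hex - 1, by omega⟩
  rw [hk] at hm hm_le
  have hxk : traj w k 0 ≤ x := by
    by_cases hki : k = i₀
    · rw [hki]; exact h0
    · have hmin : ¬ (i₀ < k ∧ x + 1 ≤ traj w k 0) := Nat.find_min hex (by omega)
      have : ¬ (x + 1 ≤ traj w k 0) := fun h => hmin ⟨by omega, h⟩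
      omega
  have hklt : k < w.length := by omega
  have hstep := trajx_succ w hklt
  have hdx := dx_le_one (st w k)
  have hdx1 : Step.dx (st w k) = 1 := by omega
  refine ⟨k, hklt, isHoriz_of_dx_ne_zero (by rw [hdx1]; decide), ?_⟩
  unfold cutOf
  rw [min_eq_left (by omega)]
  omega

/-- Discrete intermediate value, leftwards. [folklore] -/
private theorem exists_cross_left {i₀ i₁ : ℕ} (hi : i₁ < i₀) (hi₀ : i₀ ≤ w.length) {x : ℤ}
    (h0 : traj w i₀ 0 ≤ x) (h1 : x + 1 ≤ traj w i₁ 0) :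
    ∃ t < w.length, IsHoriz (st w t) ∧ cutOf w t = x := by
  classical
  have hex : ∃ i, i₁ < i ∧ traj w i 0 ≤ x := ⟨i₀, hi, h0⟩
  have hm := Nat.find_spec hex
  have hm_le : Nat.find hex ≤ i₀ := Nat.find_min' hex ⟨hi, h0⟩
  obtain ⟨k, hk⟩ : ∃ k, Nat.find hex = k + 1 := ⟨Nat.find hex - 1, by omega⟩
  rw [hk] at hm hm_le
  have hxk : x + 1 ≤ traj w k 0 := by
    by_cases hki : k = i₁
    · rw [hki]; exact h1
    · have hmin : ¬ (i₁ < k ∧ traj w k 0 ≤ x) := Nat.find_min hex (by omega)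
      have : ¬ (traj w k 0 ≤ x) := fun h => hmin ⟨by omega, h⟩
      omega
  have hklt : k < w.length := by omega
  have hstep := trajx_succ w hklt
  have hdx := dx_le_one (st w k)
  have hdx1 : Step.dx (st w k) = -1 := by omega
  refine ⟨k, hklt, isHoriz_of_dx_ne_zero (by rw [hdx1]; decide), ?_⟩
  unfold cutOf
  rw [min_eq_right (by omega)]
  omega

/-- Every cut between two visited columns is crossed, by a top strand. [folklore] -/
private theorem exists_top_of_between {x : ℤ} (h0 : ∃ i ≤ w.length, traj w i 0 ≤ x)
    (h1 : ∃ i ≤ w.length, x + 1 ≤ traj w i 0) : ∃ t ∈ topTimes w, cutOf w t = x := by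
  classical
  obtain ⟨i₀, hi₀, hx₀⟩ := h0
  obtain ⟨i₁, hi₁, hx₁⟩ := h1
  have hcross : ∃ t < w.length, IsHoriz (st w t) ∧ cutOf w t = x := by
    rcases lt_trichotomy i₀ i₁ with h | rfl | h
    · exact exists_cross_right h hi₁ hx₀ hx₁
    · omega
    · exact exists_cross_left h hi₀ hx₀ hx₁
  -- the highest strand of the cut `x`
  set S := (range w.length).filter fun t => IsHoriz (st w t) ∧ cutOf w t = x with hS
  have hne : S.Nonempty := by
    obtain ⟨t, ht, hh, hc⟩ := hcross
    exact ⟨t, by rw [hS, mem_filter, mem_range]; exact ⟨ht, hh, hc⟩⟩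
  obtain ⟨t, htS, hmax⟩ := Finset.exists_max_image S (fun t => traj w t 1) hne
  rw [hS, mem_filter, mem_range] at htS
  refine ⟨t, mem_topTimes.2 ⟨htS.1, htS.1, htS.2.1, fun t' ht' hh' hc' => ?_⟩, htS.2.2⟩
  exact hmax t' (by rw [hS, mem_filter, mem_range]; exact ⟨ht', hh', hc'.trans htS.2.2⟩)

/-- **Pigeonhole**: a self-avoiding word staying in `L + 1` rows crosses at least
`(n+1)/(L+1) - 1` distinct cuts, i.e. has at least that many top strands:
`n + 1 ≤ (L+1)(#topTimes + 1)`. [folklore] -/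
private theorem length_le_card_topTimes (hw : IsSAW w) (hs : InStrip L a w) :
    w.length + 1 ≤ (L + 1) * ((topTimes w).card + 1) := by
  classical
  set n := w.length with hn
  -- the visited columns
  set xs := (range (n + 1)).image fun i => traj w i 0 with hxs
  have hxne : xs.Nonempty := ⟨traj w 0 0, mem_image.2 ⟨0, by simp, rfl⟩⟩
  set xmin := xs.min' hxne
  set xmax := xs.max' hxne
  have hmm : xmin ≤ xmax := Finset.min'_le_max' xs hxne  -- may need args
  -- (1) vertices inject into columns × rows
  have h1 : n + 1 ≤ xs.card * (L + 1) := by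
    have hV : ((range (n + 1)).image (traj w)).card = n + 1 := by
      rw [card_image_of_injOn, card_range]
      intro i hi j hj hij
      rw [mem_coe, mem_range] at hi hj
      exact (isSAW_iff_injOn w).1 hw (show i ≤ n by omega) (show j ≤ n by omega) hij
    rw [← hV]
    have hrows : (Finset.Icc (-a) ((L : ℤ) - a)).card = L + 1 := by
      rw [Int.card_Icc]; omega
    rw [← hrows, ← card_product]
    refine card_le_card_of_injOn (fun v => (v 0, v 1)) ?_ ?_
    · intro v hv
      rw [mem_coe, mem_image] at hv
      obtain ⟨i, hi, rfl⟩ := hv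
      rw [mem_range] at hi
      rw [mem_coe, mem_product, mem_Icc]
      refine ⟨mem_image.2 ⟨i, mem_range.2 hi, rfl⟩, ?_, ?_⟩
      · have := (hs i (by omega)).1; linarith
      · have := (hs i (by omega)).2; linarith
    · intro v _ v' _ h
      simp only [Prod.mk.injEq] at h
      exact site_ext h.1 h.2
  -- (2) the columns lie between `xmin` and `xmax`
  have h2 : xs.card ≤ (xmax - xmin).toNat + 1 := by
    have : xs ⊆ Finset.Icc xmin xmax := fun x hx =>
      mem_Icc.2 ⟨xs.min'_le x hx, xs.le_max' x hx⟩
    have := card_le_card this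
    rw [Int.card_Icc] at this
    omega
  -- (3) every cut in `[xmin, xmax)` has a top strand
  have h3 : (xmax - xmin).toNat ≤ (topTimes w).card := by
    have hsub : Finset.Ico xmin xmax ⊆ (topTimes w).image (cutOf w) := by
      intro x hx
      rw [mem_Ico] at hx
      have hmin : xmin ∈ (range (n + 1)).image (fun i => traj w i 0) := xs.min'_mem hxne
      have hmax : xmax ∈ (range (n + 1)).image (fun i => traj w i 0) := xs.max'_mem hxne
      obtain ⟨i₀, hi₀, e₀⟩ := mem_image.1 hmin
      obtain ⟨i₁, hi₁, e₁⟩ := mem_image.1 hmax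
      rw [mem_range] at hi₀ hi₁
      obtain ⟨t, ht, hc⟩ := exists_top_of_between (w := w) (x := x)
        ⟨i₀, by omega, by rw [e₀]; exact hx.1⟩ ⟨i₁, by omega, by rw [e₁]; omega⟩
      exact mem_image.2 ⟨t, ht, hc⟩
    have := (card_le_card hsub).trans card_image_le
    rwa [Int.card_Ico] at this
  -- combine
  calc n + 1 ≤ xs.card * (L + 1) := h1
    _ ≤ ((xmax - xmin).toNat + 1) * (L + 1) := Nat.mul_le_mul_right _ h2
    _ ≤ ((topTimes w).card + 1) * (L + 1) := Nat.mul_le_mul_right _ (by omega)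
    _ = (L + 1) * ((topTimes w).card + 1) := by ring

end Pigeonhole

/-! ### The length of `Ψ`: at most `2L + 4` extra steps per selected cut -/

section Length

variable {L : ℕ} {a : ℤ} {w : List Step} {T : Finset ℕ}

/-- The stretched (selected, non-top) strands. [folklore] -/
private def stretched (w : List Step) (T : Finset ℕ) : Finset ℕ :=
  (range w.length).filter fun t => t ∉ T ∧ Sel w T t

/-- `|Ψ| = n + Σ_{t ∈ T} (2 exc_t + 2) + 2·#stretched`. [folklore] -/
private theorem length_Psi_eq (hT : T ⊆ topTimes w) :
    (Psi L a w T).length = w.length + ∑ t ∈ T, (2 * exc L a w t + 2) + 2 * (stretched w T).card := by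
  classical
  rw [length_Psi, blen]
  have : ∀ t ∈ range w.length, (rep L a w T t).length =
      1 + (if t ∈ T then 2 * exc L a w t + 2 else 0) + 2 * (if (t ∉ T ∧ Sel w T t) then 1 else 0) := by
    intro t _
    rw [length_rep]
    by_cases h1 : t ∈ T <;> by_cases h2 : Sel w T t <;> simp [h1, h2] <;> ring
  have hTr : range w.length ∩ T = T := inter_eq_right.2 fun t ht => mem_range.2 (lt_of_mem hT ht)
  rw [sum_congr rfl this, sum_add_distrib, sum_add_distrib, sum_const, card_range, smul_eq_mul, mul_one,
    Finset.sum_ite_mem, ← mul_sum, Finset.sum_boole, hTr]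
  simp [stretched]

/-- The stretched strands of one cut sit at distinct rows strictly below its top strand and inside the
strip: at most `y_top + a` of them. [folklore] -/
private theorem card_stretched_cut_le (hw : IsSAW w) (hT : T ⊆ topTimes w) (hs : InStrip L a w) {t₀ : ℕ}
    (h₀ : t₀ ∈ T) :
    (((stretched w T).filter fun t => cutOf w t = cutOf w t₀).card : ℤ) ≤ traj w t₀ 1 + a := by
  classical
  have h := card_le_card_of_injOn (s := (stretched w T).filter fun t => cutOf w t = cutOf w t₀)
    (t := Finset.Ico (-a) (traj w t₀ 1)) (fun t => traj w t 1) ?_ ?_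
  · rw [Int.card_Ico] at h
    have h' : (((stretched w T).filter fun t => cutOf w t = cutOf w t₀).card : ℤ) ≤
        ((traj w t₀ 1 - -a).toNat : ℤ) := by exact_mod_cast h
    have := (hs t₀ (lt_of_mem hT h₀).le).1
    rw [Int.toNat_of_nonneg (by linarith)] at h'
    linarith
  · intro t ht
    rw [mem_coe, mem_filter, stretched, mem_filter, mem_range] at ht
    obtain ⟨⟨htn, htT, hsel⟩, hc⟩ := ht
    rw [mem_coe, mem_Ico]
    refine ⟨by have := (hs t htn.le).1; linarith, lt_of_le_of_ne ?_ ?_⟩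
    · exact le_of_mem hT h₀ htn hsel.1 hc
    · exact heights_ne hw htn (lt_of_mem hT h₀) (fun h => htT (h ▸ h₀)) hsel.1 (isHoriz_of_mem hT h₀) hc.symm
  · intro t ht t' ht' hy
    rw [mem_coe, mem_filter, stretched, mem_filter, mem_range] at ht ht'
    by_contra hne
    exact heights_ne hw ht.1.1 ht'.1.1 hne ht.1.2.2.1 ht'.1.2.2.1 (ht'.2.trans ht.2.symm) hy

/-- `#stretched ≤ Σ_{t ∈ T} (y_t + a)`. [folklore] -/
private theorem card_stretched_le (hw : IsSAW w) (hT : T ⊆ topTimes w) (hs : InStrip L a w) :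
    ((stretched w T).card : ℤ) ≤ ∑ t ∈ T, (traj w t 1 + a) := by
  classical
  have hcover : stretched w T ⊆ T.biUnion fun t₀ => (stretched w T).filter fun t => cutOf w t = cutOf w t₀ := by
    intro t ht
    have ht' := ht
    rw [stretched, mem_filter] at ht'
    obtain ⟨t₀, h₀, hc⟩ := ht'.2.2.2
    exact mem_biUnion.2 ⟨t₀, h₀, mem_filter.2 ⟨ht, hc.symm⟩⟩
  have h1 := (card_le_card hcover).trans Finset.card_biUnion_le
  have h2 : ((∑ t₀ ∈ T, ((stretched w T).filter fun t => cutOf w t = cutOf w t₀).card : ℕ) : ℤ) ≤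
      ∑ t ∈ T, (traj w t 1 + a) := by
    push_cast
    exact sum_le_sum fun t₀ h₀ => card_stretched_cut_le hw hT hs h₀
  exact le_trans (by exact_mod_cast h1) h2

/-- **`|Ψ(w,T)| ≤ n + (2L+4)·#T`.** [folklore] -/
private theorem length_Psi_le (hw : IsSAW w) (hT : T ⊆ topTimes w) (hs : InStrip L a w) :
    (Psi L a w T).length ≤ w.length + (2 * L + 4) * T.card := by
  have e := length_Psi_eq (L := L) (a := a) hT
  have hst := card_stretched_le hw hT hs
  have hexc : ∀ t ∈ T, (2 * (exc L a w t : ℤ) + 2) = 2 * (L + 1 - a - traj w t 1) + 2 := by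
    intro t ht
    obtain ⟨h, -⟩ := exc_spec hs (lt_of_mem hT ht).le
    rw [h]
  have key : ((Psi L a w T).length : ℤ) ≤ w.length + (2 * L + 4) * T.card := by
    rw [e]; push_cast
    rw [sum_congr rfl hexc]
    have : ∑ t ∈ T, (2 * ((L : ℤ) + 1 - a - traj w t 1) + 2) + 2 * ∑ t ∈ T, (traj w t 1 + a) =
        (2 * L + 4) * T.card := by
      rw [mul_sum, ← sum_add_distrib]
      rw [show ((2 * (L : ℤ) + 4) * T.card) = ∑ _t ∈ T, (2 * (L : ℤ) + 4) by rw [sum_const]; simp [mul_comm]]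
      exact sum_congr rfl fun t _ => by ring
    linarith
  exact_mod_cast key

/-- `|Ψ(w,T)| ≥ n`. [folklore] -/
private theorem length_le_length_Psi : w.length ≤ (Psi L a w T).length := by
  rw [length_Psi, blen]
  calc w.length = ∑ _t ∈ range w.length, 1 := by simp
    _ ≤ ∑ t ∈ range w.length, (rep L a w T t).length := sum_le_sum fun t _ => length_rep_pos L a w T t

end Length

/-! ### The counting inequality (finite core) -/

section Counting

variable {L : ℕ} {a : ℤ}

/-- Decidability (by unfolding). [folklore] -/
private instance (L : ℕ) (a : ℤ) (w : List Step) : Decidable (InStrip L a w) := by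
  unfold InStrip; infer_instance

/-- The self-avoiding words of length `n` staying in the rows `-a, …, L - a`. [folklore] -/
private def stripWords (L : ℕ) (a : ℤ) (n : ℕ) : Finset (List Step) := (sawWords n).filter (InStrip L a)

/-- Membership in `stripWords`. [folklore] -/
private theorem mem_stripWords {n : ℕ} {w : List Step} :
    w ∈ stripWords L a n ↔ w.length = n ∧ IsSAW w ∧ InStrip L a w := by
  simp [stripWords, and_assoc]

/-- `Σ_{T ⊆ s} y^{#T} = (1 + y)^{#s}`. [folklore] -/
private theorem sum_powerset_pow (s : Finset ℕ) (y : ℝ) : ∑ T ∈ s.powerset, y ^ T.card = (1 + y) ^ s.card := by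
  have := Finset.sum_pow_mul_eq_add_pow y 1 s
  simp only [one_pow, mul_one] at this
  rw [this, add_comm]

/-- **The finite core**: for `0 ≤ x ≤ 1`,
`#strip(L,a,n) · xⁿ · (1 + x^{2L+4})^{(n+1)/(L+1) - 1} ≤ Σ_{m = n}^{(2L+5)n} c_m x^m`. [folklore] -/
private theorem core_ineq (n : ℕ) {x : ℝ} (hx0 : 0 ≤ x) (hx1 : x ≤ 1) :
    ((stripWords L a n).card : ℝ) * (x ^ n * (1 + x ^ (2 * L + 4)) ^ (((n : ℝ) + 1) / (L + 1) - 1)) ≤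
      ∑ m ∈ Finset.Icc n ((2 * L + 5) * n), ((sawWords m).card : ℝ) * x ^ m := by
  classical
  set B := 1 + x ^ (2 * L + 4) with hB
  have hB1 : 1 ≤ B := by have := pow_nonneg hx0 (2 * L + 4); linarith
  have hL : (0 : ℝ) < L + 1 := by positivity
  -- the index set of pairs `(w, T)` and the insertion map
  set D := (stripWords L a n).sigma fun w => (topTimes w).powerset with hD
  set f : (Σ _ : List Step, Finset ℕ) → List Step := fun p => Psi L a p.1 p.2 with hf
  set Tgt := (Finset.Icc n ((2 * L + 5) * n)).biUnion sawWords with hTgt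
  -- Step 1
  have step1 : ∀ w ∈ stripWords L a n,
      x ^ n * B ^ (((n : ℝ) + 1) / (L + 1) - 1) ≤ x ^ n * B ^ ((topTimes w).card : ℝ) := by
    intro w hw
    obtain ⟨hl, hsaw, hs⟩ := mem_stripWords.1 hw
    refine mul_le_mul_of_nonneg_left (Real.rpow_le_rpow_of_exponent_le hB1 ?_) (pow_nonneg hx0 n)
    have h := length_le_card_topTimes hsaw hs
    rw [hl] at h
    have h' : ((n : ℝ) + 1) ≤ (L + 1) * ((topTimes w).card + 1) := by exact_mod_cast h
    rw [div_sub_one hL.ne', div_le_iff₀ hL]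
    nlinarith
  -- Steps 2–3: expand `B^{#top}` over subsets and bound each term by `x^{|Ψ|}`
  have step23 : ∀ w ∈ stripWords L a n, x ^ n * B ^ ((topTimes w).card : ℝ) ≤
      ∑ T ∈ (topTimes w).powerset, x ^ (Psi L a w T).length := by
    intro w hw
    obtain ⟨hl, hsaw, hs⟩ := mem_stripWords.1 hw
    rw [Real.rpow_natCast, hB, ← sum_powerset_pow, mul_sum]
    refine sum_le_sum fun T hT => ?_
    rw [mem_powerset] at hT
    rw [← pow_mul, ← pow_add]
    refine pow_le_pow_of_le_one hx0 hx1 ?_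
    have := length_Psi_le (L := L) (a := a) hsaw hT hs
    rw [hl] at this
    linarith
  -- Step 4: injectivity
  have hinj : Set.InjOn f D := by
    rintro ⟨w, T⟩ hp ⟨w', T'⟩ hp' h
    rw [hD, mem_coe, mem_sigma, mem_powerset] at hp hp'
    obtain ⟨hl, hsaw, hs⟩ := mem_stripWords.1 hp.1
    obtain ⟨hl', hsaw', hs'⟩ := mem_stripWords.1 hp'.1
    obtain ⟨rfl, rfl⟩ := Psi_injective hsaw hp.2 hs hsaw' hp'.2 hs' (hl.trans hl'.symm) h
    rfl
  -- Step 5: the image lies in the target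
  have himg : D.image f ⊆ Tgt := by
    intro W hW
    obtain ⟨⟨w, T⟩, hp, rfl⟩ := mem_image.1 hW
    rw [hD, mem_sigma, mem_powerset] at hp
    obtain ⟨hl, hsaw, hs⟩ := mem_stripWords.1 hp.1
    rw [hTgt, mem_biUnion]
    refine ⟨(Psi L a w T).length, mem_Icc.2 ⟨?_, ?_⟩, mem_sawWords.2 ⟨rfl, isSAW_Psi hsaw hp.2⟩⟩
    · rw [← hl]; exact length_le_length_Psi
    · have h1 := length_Psi_le (L := L) (a := a) hsaw hp.2 hs
      have h2 : T.card ≤ w.length := (card_le_card hp.2).trans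
        ((card_le_card (filter_subset _ _)).trans (by simp))
      rw [hl] at h1 h2
      nlinarith
  -- Step 6: the target sum
  have htgt : ∑ W ∈ Tgt, x ^ W.length = ∑ m ∈ Finset.Icc n ((2 * L + 5) * n), ((sawWords m).card : ℝ) * x ^ m := by
    rw [hTgt, sum_biUnion]
    · refine sum_congr rfl fun m _ => ?_
      rw [sum_congr rfl fun W hW => by rw [(mem_sawWords.1 hW).1], sum_const, nsmul_eq_mul]
    · intro m _ m' _ hne
      exact Finset.disjoint_left.2 fun W h1 h2 => hne ((mem_sawWords.1 h1).1.symm.trans (mem_sawWords.1 h2).1)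
  -- assemble
  calc ((stripWords L a n).card : ℝ) * (x ^ n * B ^ (((n : ℝ) + 1) / (L + 1) - 1))
      = ∑ w ∈ stripWords L a n, x ^ n * B ^ (((n : ℝ) + 1) / (L + 1) - 1) := by
        rw [sum_const, nsmul_eq_mul]
    _ ≤ ∑ w ∈ stripWords L a n, ∑ T ∈ (topTimes w).powerset, x ^ (Psi L a w T).length :=
        sum_le_sum fun w hw => (step1 w hw).trans (step23 w hw)
    _ = ∑ p ∈ D, x ^ (f p).length := by rw [hD, sum_sigma]
    _ = ∑ W ∈ D.image f, x ^ W.length := by rw [sum_image hinj]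
    _ ≤ ∑ W ∈ Tgt, x ^ W.length :=
        sum_le_sum_of_subset_of_nonneg himg fun W _ _ => pow_nonneg hx0 _
    _ = _ := htgt

/-! ### From the finite core to the connective constants -/

/-- Membership in the planar strip `R[1,L] ⊂ ℤ²` is a condition on the second coordinate.
[folklore] -/
private theorem inTube_two_one {L : ℕ} {v : Site 2} : Zd.InTube 2 1 L v ↔ 0 ≤ v 1 ∧ v 1 ≤ L := by
  constructor
  · intro h; exact h 1 (by simp)
  · intro h i hi
    have : i = 1 := by
      apply Fin.ext
      have := i.isLt
      simp only [Fin.val_one]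
      omega
    subst this; exact h

/-- The walks of `S_N(R[1,L])` from the start `b` are the strip words at height `b 1`. [folklore] -/
private theorem card_tubeWalksFrom_eq (L n : ℕ) (b : Site 2) :
    (Zd.tubeWalksFrom 2 1 L n b).card = (stripWords L (b 1) n).card := by
  classical
  have h1 : Zd.tubeWalksFrom 2 1 L n b =
      ((sawWords n).filter fun w => ∀ m ≤ n, Zd.InTube 2 1 L (b + traj w m)).image traj := by
    rw [Zd.tubeWalksFrom, ← image_traj_sawWords, filter_image]
  have h2 : ((sawWords n).filter fun w => ∀ m ≤ n, Zd.InTube 2 1 L (b + traj w m)) = stripWords L (b 1) n := by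
    ext w
    simp only [mem_filter, mem_sawWords, stripWords, InStrip]
    constructor
    · rintro ⟨⟨hl, hs⟩, h⟩
      refine ⟨⟨hl, hs⟩, fun i hi => ?_⟩
      have := (inTube_two_one.1 (h i (by rw [← hl]; exact hi)))
      simpa [Pi.add_apply] using this
    · rintro ⟨⟨hl, hs⟩, h⟩
      refine ⟨⟨hl, hs⟩, fun m hm => inTube_two_one.2 ?_⟩
      have := h m (by rw [hl]; exact hm)
      simpa [Pi.add_apply] using this
  rw [h1, card_image_of_injOn, h2]
  exact fun w hw w' hw' h => traj_injOn n (filter_subset _ _ hw |> fun h => by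
    rw [mem_coe, mem_words]; exact (mem_sawWords.1 h).1) (filter_subset _ _ hw' |> fun h => by
    rw [mem_coe, mem_words]; exact (mem_sawWords.1 h).1) h

/-- `μ(R[1,L])^N ≤ c_N(R[1,L])`. [folklore] -/
private theorem pow_tubeConnectiveConstant_le (L N : ℕ) :
    Zd.tubeConnectiveConstant 2 1 L ^ N ≤ (Zd.tubeCount 2 1 L N : ℝ) := by
  rcases Nat.eq_zero_or_pos N with rfl | hN
  · rw [pow_zero]
    exact_mod_cast Zd.one_le_tubeCount (d := 2) le_rfl L 0
  have h := Zd.tubeConnectiveConstant_le_rpow (d := 2) 1 L hN.ne'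
  have h0 : (0 : ℝ) ≤ Zd.tubeConnectiveConstant 2 1 L := (Zd.tubeConnectiveConstant_pos (d := 2) le_rfl L).le
  calc Zd.tubeConnectiveConstant 2 1 L ^ N ≤ ((Zd.tubeCount 2 1 L N : ℝ) ^ (1 / (N : ℝ))) ^ N :=
        pow_le_pow_left₀ h0 h N
    _ = Zd.tubeCount 2 1 L N := by rw [one_div, Real.rpow_inv_natCast_pow (Nat.cast_nonneg _) hN.ne']

/-- Below the critical fugacity the terms `c_m x^m` are bounded. [folklore] -/
private theorem exists_bound_count_mul_pow {x : ℝ} (hx0 : 0 < x) (hx : x < connectiveConstant⁻¹) :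
    ∃ K : ℝ, 1 ≤ K ∧ ∀ m, ((sawWords m).card : ℝ) * x ^ m ≤ K := by
  have hμ : 0 < connectiveConstant := by
    rw [← Zd.connectiveConstant_two]; exact Zd.connectiveConstant_pos 2
  have hlt : Zd.connectiveConstant 2 < x⁻¹ := by
    rw [Zd.connectiveConstant_two]; rwa [lt_inv_comm₀ hμ hx0]
  have hev := (tendsto_order.1 (Zd.tendsto_count_rpow 2)).2 _ hlt
  obtain ⟨N, hN⟩ := Filter.eventually_atTop.1 hev
  refine ⟨1 + ∑ m ∈ range (N + 1), ((sawWords m).card : ℝ) * x ^ m, ?_, fun m => ?_⟩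
  · have : 0 ≤ ∑ m ∈ range (N + 1), ((sawWords m).card : ℝ) * x ^ m :=
      sum_nonneg fun m _ => by positivity
    linarith
  rcases lt_or_ge m (N + 1) with hm | hm
  · have : ((sawWords m).card : ℝ) * x ^ m ≤ ∑ m ∈ range (N + 1), ((sawWords m).card : ℝ) * x ^ m :=
      single_le_sum (f := fun m => ((sawWords m).card : ℝ) * x ^ m) (fun m _ => by positivity) (mem_range.2 hm)
    linarith
  · have hm0 : m ≠ 0 := by omega
    have h := hN m (by omega)
    rw [card_sawWords]
    have hc : (0 : ℝ) ≤ Zd.count 2 m := Nat.cast_nonneg _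
    have : (Zd.count 2 m : ℝ) * x ^ m < 1 := by
      have h1 : (Zd.count 2 m : ℝ) = ((Zd.count 2 m : ℝ) ^ (1 / (m : ℝ))) ^ m := by
        rw [one_div, Real.rpow_inv_natCast_pow hc hm0]
      have h2 : ((Zd.count 2 m : ℝ) ^ (1 / (m : ℝ))) ^ m < (x⁻¹) ^ m :=
        pow_lt_pow_left₀ h (Real.rpow_nonneg hc _) hm0
      rw [h1]
      calc ((Zd.count 2 m : ℝ) ^ (1 / (m : ℝ))) ^ m * x ^ m < (x⁻¹) ^ m * x ^ m :=
            mul_lt_mul_of_pos_right h2 (pow_pos hx0 m)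
        _ = 1 := by rw [← mul_pow, inv_mul_cancel₀ hx0.ne', one_pow]
    have : 0 ≤ ∑ m ∈ range (N + 1), ((sawWords m).card : ℝ) * x ^ m :=
      sum_nonneg fun m _ => by positivity
    linarith

/-- **Subcritical inequality**: for `0 < x < 1/μ`,
`log(μ(R[1,L])·x) + log(1 + x^{2L+4})/(L+1) ≤ 0`. [folklore] -/
private theorem log_ineq_of_lt (L : ℕ) {x : ℝ} (hx0 : 0 < x) (hx : x < connectiveConstant⁻¹) :
    Real.log (Zd.tubeConnectiveConstant 2 1 L * x) + Real.log (1 + x ^ (2 * L + 4)) / (L + 1) ≤ 0 := by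
  classical
  refine le_of_not_gt fun hcon => ?_
  set μL := Zd.tubeConnectiveConstant 2 1 L with hμL
  set B := 1 + x ^ (2 * L + 4) with hB
  set δ := Real.log (μL * x) + Real.log B / (L + 1) with hδ
  have hμLpos : 0 < μL := Zd.tubeConnectiveConstant_pos (d := 2) le_rfl L
  have hμ : 0 < connectiveConstant := by
    rw [← Zd.connectiveConstant_two]; exact Zd.connectiveConstant_pos 2
  have hx1 : x ≤ 1 := by
    have h26 : (1 : ℝ) ≤ connectiveConstant := by
      rw [← Zd.connectiveConstant_two]; exact Zd.one_le_connectiveConstant 2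
    have : connectiveConstant⁻¹ ≤ 1 := inv_le_one_of_one_le₀ h26
    linarith
  have hB1 : 1 ≤ B := by have := pow_nonneg hx0.le (2 * L + 4); linarith
  have hlogB : 0 ≤ Real.log B := Real.log_nonneg hB1
  have hL : (0 : ℝ) < L + 1 := by positivity
  obtain ⟨K, hK1, hK⟩ := exists_bound_count_mul_pow hx0 hx
  set C₁ := ((Zd.tubeStarts 2 1 L).card : ℝ) with hC₁
  have hC₁1 : 1 ≤ C₁ := by
    have : 1 ≤ (Zd.tubeStarts 2 1 L).card := Finset.card_pos.2 ⟨0, Zd.zero_mem_tubeStarts 2 1 L⟩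
    rw [hC₁]; exact_mod_cast this
  -- the inequality for every `n ≥ 1`
  have main : ∀ n : ℕ, 1 ≤ n →
      (n : ℝ) * δ - Real.log B ≤ Real.log (C₁ * K * (2 * L + 5)) + Real.log n := by
    intro n hn
    have hn0 : (0 : ℝ) < n := by exact_mod_cast hn
    -- (i) summing the finite core over the starting heights
    have hsum : (Zd.tubeCount 2 1 L n : ℝ) * (x ^ n * B ^ (((n : ℝ) + 1) / (L + 1) - 1)) ≤
        C₁ * (((2 * L + 4) * n + 1) * K) := by
      rw [Zd.tubeCount_eq_sum]
      push_cast
      rw [sum_mul, hC₁, show ((Zd.tubeStarts 2 1 L).card : ℝ) * (((2 * L + 4) * n + 1) * K) =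
        ∑ _b ∈ Zd.tubeStarts 2 1 L, (((2 * L + 4) * n + 1) * K) by rw [sum_const, nsmul_eq_mul]]
      refine sum_le_sum fun b _ => ?_
      rw [card_tubeWalksFrom_eq]
      refine (core_ineq n hx0.le hx1).trans ?_
      calc ∑ m ∈ Finset.Icc n ((2 * L + 5) * n), ((sawWords m).card : ℝ) * x ^ m
          ≤ ∑ _m ∈ Finset.Icc n ((2 * L + 5) * n), K := sum_le_sum fun m _ => hK m
        _ = (((2 * L + 5) * n + 1 - n : ℕ) : ℝ) * K := by rw [sum_const, nsmul_eq_mul, Nat.card_Icc]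
        _ = ((2 * L + 4) * n + 1) * K := by
            congr 1
            rw [show (2 * L + 5) * n + 1 - n = (2 * L + 4) * n + 1 by
              rw [show (2 * L + 5) * n = (2 * L + 4) * n + n by ring]; omega]
            push_cast; ring
    -- (ii) lower bound by `μ_L^n`
    have hlow : (μL * x) ^ n * B ^ (((n : ℝ) + 1) / (L + 1) - 1) ≤ C₁ * (((2 * L + 4) * n + 1) * K) := by
      refine le_trans ?_ hsum
      rw [mul_pow, mul_assoc]
      exact mul_le_mul_of_nonneg_right (pow_tubeConnectiveConstant_le L n)
        (mul_nonneg (pow_nonneg hx0.le n) (Real.rpow_nonneg (by linarith) _))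
    -- (iii) logarithms
    have hpos1 : 0 < (μL * x) ^ n * B ^ (((n : ℝ) + 1) / (L + 1) - 1) :=
      mul_pos (pow_pos (mul_pos hμLpos hx0) n) (Real.rpow_pos_of_pos (by linarith) _)
    have hlog := Real.log_le_log hpos1 hlow
    rw [Real.log_mul (pow_pos (mul_pos hμLpos hx0) n).ne' (Real.rpow_pos_of_pos (by linarith) _).ne',
      Real.log_pow, Real.log_rpow (by linarith)] at hlog
    have hrhs : Real.log (C₁ * (((2 * L + 4) * n + 1) * K)) ≤ Real.log (C₁ * K * (2 * L + 5)) + Real.log n := by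
      rw [← Real.log_mul (by positivity) hn0.ne']
      refine Real.log_le_log (by positivity) ?_
      have hn1 : (1 : ℝ) ≤ n := by exact_mod_cast hn
      have hL0 : (0 : ℝ) ≤ L := Nat.cast_nonneg L
      have h45 : ((2 : ℝ) * L + 4) * n + 1 ≤ (2 * L + 5) * n := by nlinarith
      have hCK : 0 ≤ C₁ * K := mul_nonneg (by linarith) (by linarith)
      calc C₁ * (((2 * L + 4) * n + 1) * K) = C₁ * K * (((2 : ℝ) * L + 4) * n + 1) := by ring
        _ ≤ C₁ * K * ((2 * L + 5) * n) := mul_le_mul_of_nonneg_left h45 hCK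
        _ = C₁ * K * (2 * L + 5) * n := by ring
    have hexp : (n : ℝ) * δ - Real.log B ≤ n * Real.log (μL * x) + (((n : ℝ) + 1) / (L + 1) - 1) * Real.log B := by
      rw [hδ]
      have : (n : ℝ) * (Real.log B / (L + 1)) ≤ ((n : ℝ) + 1) / (L + 1) * Real.log B := by
        rw [mul_div_assoc', div_mul_eq_mul_div]
        exact div_le_div_of_nonneg_right (by nlinarith) hL.le
      nlinarith
    linarith
  -- (iv) `log n = o(n)`: contradiction for large `n`
  have hδ0 : 0 < δ := hcon
  have ho := (Real.isLittleO_log_id_atTop.comp_tendsto tendsto_natCast_atTop_atTop).def (half_pos hδ0)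
  have hev2 : ∀ᶠ n : ℕ in Filter.atTop, Real.log (C₁ * K * (2 * L + 5)) + Real.log B + 1 ≤ (n : ℝ) * (δ / 2) := by
    obtain ⟨N, hN⟩ := exists_nat_gt ((Real.log (C₁ * K * (2 * L + 5)) + Real.log B + 1) / (δ / 2))
    refine Filter.eventually_atTop.2 ⟨N, fun n hn => ?_⟩
    have : (N : ℝ) ≤ n := by exact_mod_cast hn
    rw [div_lt_iff₀ (half_pos hδ0)] at hN
    nlinarith
  obtain ⟨n, ⟨hn1, hlog⟩, hbig⟩ := ((Filter.eventually_ge_atTop 1).and ho).and hev2 |>.exists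
  have hm := main n hn1
  have hn0 : (0 : ℝ) < n := by exact_mod_cast hn1
  have hlog' : Real.log n ≤ δ / 2 * n := by
    have := hlog
    simp only [Function.comp, id, Real.norm_eq_abs] at this
    rw [abs_of_nonneg (Real.log_natCast_nonneg n), abs_of_nonneg hn0.le] at this
    exact this
  nlinarith

/-- **Explicit lower locality rate for planar strips** (quantitative form, this file, of the
strict inequality `μ(R[1,T]) < μ` of Madras–Slade (8.2.11), case `d = 2`, `k = 1`):
`log μ - log μ(ℤ × {0,…,L}) ≥ log(1 + μ^{-(2L+4)}) / (L+1)` for every `L`, where `μ = μ(ℤ²)`.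
Proof: two-column insertion at the column cuts of a strip walk (every cut is a free site for an
excursion over the top of the strip; at least `(n+1)/(L+1) - 1` cuts; at most `2L + 4` extra steps per
selected cut), decoded by the columns reaching row `L + 1`; no transfer matrix, no pattern theorem.
[cite: MadrasSlade1993, Theorem 8.2.1, eq. (8.2.11)] -/
private theorem log_sub_log_tubeConnectiveConstant_ge (L : ℕ) :
    Real.log (1 + connectiveConstant⁻¹ ^ (2 * L + 4)) / (L + 1) ≤
      Real.log connectiveConstant - Real.log (Zd.tubeConnectiveConstant 2 1 L) := by
  set μL := Zd.tubeConnectiveConstant 2 1 L with hμL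
  have hμLpos : 0 < μL := Zd.tubeConnectiveConstant_pos (d := 2) le_rfl L
  have hμ : 0 < connectiveConstant := by
    rw [← Zd.connectiveConstant_two]; exact Zd.connectiveConstant_pos 2
  set x₀ := connectiveConstant⁻¹ with hx₀
  have hx₀pos : 0 < x₀ := inv_pos.2 hμ
  set g : ℝ → ℝ := fun x => Real.log (μL * x) + Real.log (1 + x ^ (2 * L + 4)) / (L + 1) with hg
  have hcont : ContinuousAt g x₀ := by
    have h1 : ContinuousAt (fun x => Real.log (μL * x)) x₀ :=
      (Real.continuousAt_log (mul_pos hμLpos hx₀pos).ne').comp (continuousAt_const.mul continuousAt_id)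
    have h2 : ContinuousAt (fun x : ℝ => Real.log (1 + x ^ (2 * L + 4)) / (L + 1)) x₀ := by
      refine ContinuousAt.div_const ?_ _
      exact (Real.continuousAt_log (by positivity)).comp (continuousAt_const.add (continuousAt_id.pow _))
    exact h1.add h2
  have hlim : Filter.Tendsto g (𝓝[<] x₀) (𝓝 (g x₀)) := hcont.tendsto.mono_left nhdsWithin_le_nhds
  have hev : ∀ᶠ x in 𝓝[<] x₀, g x ≤ 0 := by
    filter_upwards [Ioo_mem_nhdsLT hx₀pos] with x hx
    exact log_ineq_of_lt L hx.1 hx.2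
  have hgx₀ : g x₀ ≤ 0 := le_of_tendsto hlim hev
  have e : g x₀ = Real.log μL - Real.log connectiveConstant +
      Real.log (1 + connectiveConstant⁻¹ ^ (2 * L + 4)) / (L + 1) := by
    rw [hg]
    simp only
    rw [Real.log_mul hμLpos.ne' hx₀pos.ne', hx₀, Real.log_inv]
    ring
  linarith

/-- **Madras–Slade (8.2.11) for planar strips, as printed**: `μ(ℤ × {0,…,L}) < μ(ℤ²)` for every `L`
("`μ(R[k,T]) < μ` for every `T`", Theorem 8.2.1, case `d = 2`, `k = 1`; book p. 281). The printed proof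
invokes the pattern theorem; here it follows from the explicit margin
`log_sub_log_tubeConnectiveConstant_ge`. [cite: MadrasSlade1993, Theorem 8.2.1, eq. (8.2.11)] -/
private theorem tubeConnectiveConstant_two_one_lt (L : ℕ) : Zd.tubeConnectiveConstant 2 1 L < connectiveConstant := by
  have h := log_sub_log_tubeConnectiveConstant_ge L
  have hμ : 0 < connectiveConstant := by
    rw [← Zd.connectiveConstant_two]; exact Zd.connectiveConstant_pos 2
  have hμL : 0 < Zd.tubeConnectiveConstant 2 1 L := Zd.tubeConnectiveConstant_pos (d := 2) le_rfl L
  have hpos : 0 < Real.log (1 + connectiveConstant⁻¹ ^ (2 * L + 4)) / (L + 1) := by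
    refine div_pos (Real.log_pos ?_) (by positivity)
    have := pow_pos (inv_pos.2 hμ) (2 * L + 4)
    linarith
  have : Real.log (Zd.tubeConnectiveConstant 2 1 L) < Real.log connectiveConstant := by linarith
  exact (Real.log_lt_log_iff hμL hμ).1 this

end Counting

end StripInsert

namespace Zd

/-- **Explicit lower locality rate for planar strips** — quantitative form (this file) of the strict
inequality (8.2.11) `μ(R[1,T]) < μ` of Madras–Slade, Theorem 8.2.1, case `d = 2`, `k = 1`:
`log(1 + μ^{-(2L+4)}) / (L+1) ≤ log μ - log μ(ℤ × {0,…,L})` for every `L ≥ 0`, `μ = μ(ℤ²) =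
`connectiveConstant 2`. Proof by
two-column insertion at the column cuts of a strip walk (see the module docstring); no pattern theorem.
[cite: MadrasSlade1993, Theorem 8.2.1, eq. (8.2.11)] -/
theorem log_sub_log_tubeConnectiveConstant_two_one_ge (L : ℕ) :
    Real.log (1 + (connectiveConstant 2)⁻¹ ^ (2 * L + 4)) / (L + 1) ≤
      Real.log (connectiveConstant 2) - Real.log (tubeConnectiveConstant 2 1 L) := by
  rw [connectiveConstant_two]
  exact StripInsert.log_sub_log_tubeConnectiveConstant_ge L

/-- **Madras–Slade (8.2.11) for planar strips, as printed**: "`μ(R[k,T]) < μ` for every `T`"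
(Theorem 8.2.1), here `d = 2`, `k = 1`: `μ(ℤ × {0,…,L}) < μ(ℤ²)` for every `L`. The printed proof is
"an immediate consequence of the Pattern Theorem"; this one is constructive, via the explicit margin
`log_sub_log_tubeConnectiveConstant_two_one_ge`. [cite: MadrasSlade1993, Theorem 8.2.1, eq. (8.2.11)] -/
theorem tubeConnectiveConstant_two_one_lt_connectiveConstant (L : ℕ) :
    tubeConnectiveConstant 2 1 L < connectiveConstant 2 := by
  rw [connectiveConstant_two]
  exact StripInsert.tubeConnectiveConstant_two_one_lt L

end Zd

end Literature.Probability.RandomPlanarGeometry.SAW
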